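import Summits.Parity.GeneralizedHardyLittlewood.Theorems.PrimeLevelFamEdgeMomentsBeyondDiagonalDiagDecorOrderFourFourCombine
import Summits.Parity.GeneralizedHardyLittlewood.Theorems.PrimeLevelFamEdgeMomentsBeyondDiagonalDiagDecorOrderTwoFourPoly
import Summits.Parity.GeneralizedHardyLittlewood.Theorems.PrimeLevelFamEdgeMomentsBeyondDiagonalDiagDecorM8Family
import Summits.Parity.GeneralizedHardyLittlewood.Theorems.PrimeLevelFamEdgeMomentsBeyondDiagonalDiagDecorM6P2Family
import Summits.Parity.GeneralizedHardyLittlewood.Theorems.PrimeLevelFamEdgeMomentsBeyondDiagonalDiagDecorM4M4Family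
import Summits.Parity.GeneralizedHardyLittlewood.Theorems.PrimeLevelFamEdgeMomentsBeyondDiagonalDiagDecorM4P2Family
import HarnessLib

/-!
# Route `PrimeLevelFamEdge`, crux K_A `MomentsBeyondDiagonal` (stmt-Parity-20007), line «petersson_layers» v4, stub `stub_diag`:
# **(Poly₄₄) PROVED: the polynomial part of the order-`(4,4)` target from seventy landed engine instances**

The seventy monomials of `…DiagDecorOrderFourFourSplit.selbergOrderFourFour_split` (poly₄₄) are ALL covered by landed engines:
`…ShiftedLpow.abs_selbergLpow_sub_le` (`ττL^m`, `m ≤ 9`), `…ShiftedP2Lpow.abs_selbergP2Lpow_sub_le(')` (`m ≤ 7`),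
`…ShiftedP2P2Lpow.abs_selbergP2P2Lpow_sub_le` (`m ≤ 5`), `…DiagDecorM4Family.abs_selbergM4Lpow_le(')` (`m ≤ 5`, `log^m`),
`…DiagDecorM6Family` (`m ≤ 3`, `log^{m+2}`), `…DiagDecorM4P2Family` (`m ≤ 3`, `log^{m+2}`), `…DiagDecorM8Family` (`m ≤ 1`, `log^{m+4}`),
`…DiagDecorM6P2Family` (`m ≤ 1`, `log^{m+4}`), `…DiagDecorM4M4Family` (`m ≤ 1`, `log^{m+4}`) (lineage famedge-2 g4–g7), combined by
`…DiagDecorOrderFourFourCombine.orderFourFour_combine` (p839407):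
* `abs_selbergOrderFourFourPoly_sub_le` — **`|Sel(poly₄₄)(M) − (π²/6)²(Φ₉/4608 − Ψ₇/448 + 9Ξ₅/640)(λ,P)·log⁶M| ≤ C·log⁵M`** (`M ≥ 3`);
* `orderFourFourPoly` — the same in the hypothesis shape (Poly₄₄) of `…DiagDecorOrderFourFourAssembly.orderFourFour_target_of_poly_of_remainder`
  (`𝔎₄₄(λ,P) = (π²/6)²(Φ₉(λ,P)/4608 − Ψ₇(λ,P)/448 + 9Ξ₅(λ,P)/640)`, the block functionals of the three main engines) — so the order-(4,4)
  target, hence RUNG 4 of `stub_diag`, is reduced to the remainder estimate (R₄₄) ALONE.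

Def-free; theorems only. Helper `--supports stmt-Parity-20007`; closes nothing; K_A, K_B and the Parity summit are NOT proved;
nothing about Landau–Siegel zeros.

## References
* E. Kowalski, P. Michel, J. VanderKam, J. reine angew. Math. 526 (2000), (23)–(28) pp. 13–15 and Prop. 5.1 p. 18.
  [cite: KowalskiMichelVanderKam2000, (23)–(28) — derivation (order-(4,4) piece of the diagonal main term, general Q)]
-/

noncomputable section

open scoped Real ArithmeticFunction.Moebius
open Literature.NumberTheory.LFunctions Literature.NumberTheory.LFunctions.KMV2000
open Literature.NumberTheory.Sieve (one_le_log_of_three_le)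
open Finset ArithmeticFunction Polynomial MeasureTheory Set

namespace Summit.Parity.GeneralizedHardyLittlewood.Theorems.MomentsBeyondDiagonal.DiagKernel

open Literature.NumberTheory.LFunctions Literature.NumberTheory.LFunctions.KMV2000

set_option maxHeartbeats 4000000 in
set_option maxRecDepth 16384 in
-- seventy engine instances, large statement
/-- **`|Sel(poly₄₄)(M) − (π²/6)²(Φ₉/4608 − Ψ₇/448 + 9Ξ₅/640)(λ,P)·log⁶M| ≤ C·log⁵M`** for `M ≥ 3`, `P₀ = P₁ = 0`, `λ ∈ [0,1]` and any
`E_ab`, `μ₂, μ₄, μ₆, μ₈` (module docstring). [cite: KowalskiMichelVanderKam2000, (23)–(28) and Prop. 5.1 — derivation] -/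
theorem abs_selbergOrderFourFourPoly_sub_le (P : ℝ[X]) (hP0 : P.coeff 0 = 0) (hP1 : P.coeff 1 = 0)
    {lam : ℝ} (hlam0 : 0 ≤ lam) (hlam1 : lam ≤ 1) (E₀₀ E₀₁ E₀₂ E₀₃ E₀₄ E₁₀ E₁₁ E₁₂ E₁₃ E₁₄ E₂₀ E₂₁ E₂₂ E₂₃ E₂₄ E₃₀ E₃₁ E₃₂ E₃₃ E₃₄ E₄₀ E₄₁ E₄₂ E₄₃ E₄₄ μ₂ μ₄ μ₆ μ₈ : ℝ) :
    ∃ C : ℝ, ∀ M : ℝ, 3 ≤ M →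
      |∑ c ∈ Icc 1 ⌊M⌋₊, ∑ g ∈ Icc 1 (⌊M⌋₊ / c), (μ g : ℝ) * c *
        ∑ k₁ ∈ Icc 1 (⌊M⌋₊ / (c * g)), ∑ k₂ ∈ Icc 1 (⌊M⌋₊ / (c * g)),
          ((μ (c * g * k₁) : ℝ) * ((psi (c * g * k₁))⁻¹ *
              P.eval (Real.log (M / ((c * g * k₁ : ℕ) : ℝ)) / Real.log M)) / ((c * g * k₁ : ℕ) : ℝ)) *
            ((μ (c * g * k₂) : ℝ) * ((psi (c * g * k₂))⁻¹ *
              P.eval (Real.log (M / ((c * g * k₂ : ℕ) : ℝ)) / Real.log M)) / ((c * g * k₂ : ℕ) : ℝ)) *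
            ((1 / 4608) * ((k₁.divisors.card : ℝ) * (k₂.divisors.card : ℝ) * (2 * (lam * Real.log M) - 2 * Real.log g - Real.log k₁ - Real.log k₂) ^ (9 : ℕ)) +
              (E₀₀ / 256) * ((k₁.divisors.card : ℝ) * (k₂.divisors.card : ℝ) * (2 * (lam * Real.log M) - 2 * Real.log g - Real.log k₁ - Real.log k₂) ^ (8 : ℕ)) +
              (E₀₁ / 32 + E₁₀ / 32 - μ₂ / 56) * ((k₁.divisors.card : ℝ) * (k₂.divisors.card : ℝ) * (2 * (lam * Real.log M) - 2 * Real.log g - Real.log k₁ - Real.log k₂) ^ (7 : ℕ)) +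
              (3 * E₀₂ / 32 + E₁₁ / 4 + 3 * E₂₀ / 32) * ((k₁.divisors.card : ℝ) * (k₂.divisors.card : ℝ) * (2 * (lam * Real.log M) - 2 * Real.log g - Real.log k₁ - Real.log k₂) ^ (6 : ℕ)) +
              (E₀₃ / 8 + 3 * E₁₂ / 4 + 3 * E₂₁ / 4 + E₃₀ / 8 + 3 * μ₄ / 20) * ((k₁.divisors.card : ℝ) * (k₂.divisors.card : ℝ) * (2 * (lam * Real.log M) - 2 * Real.log g - Real.log k₁ - Real.log k₂) ^ (5 : ℕ)) +
              (E₀₄ / 16 + E₁₃ + 9 * E₂₂ / 4 + E₃₁ + E₄₀ / 16) * ((k₁.divisors.card : ℝ) * (k₂.divisors.card : ℝ) * (2 * (lam * Real.log M) - 2 * Real.log g - Real.log k₁ - Real.log k₂) ^ (4 : ℕ)) +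
              (E₁₄ / 2 + 3 * E₂₃ + 3 * E₃₂ + E₄₁ / 2 - 2 * μ₆ / 3) * ((k₁.divisors.card : ℝ) * (k₂.divisors.card : ℝ) * (2 * (lam * Real.log M) - 2 * Real.log g - Real.log k₁ - Real.log k₂) ^ (3 : ℕ)) +
              (3 * E₂₄ / 2 + 4 * E₃₃ + 3 * E₄₂ / 2) * ((k₁.divisors.card : ℝ) * (k₂.divisors.card : ℝ) * (2 * (lam * Real.log M) - 2 * Real.log g - Real.log k₁ - Real.log k₂) ^ (2 : ℕ)) +
              (2 * E₃₄ + 2 * E₄₃ + 2 * μ₈) * ((k₁.divisors.card : ℝ) * (k₂.divisors.card : ℝ) * (2 * (lam * Real.log M) - 2 * Real.log g - Real.log k₁ - Real.log k₂) ^ (1 : ℕ)) +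
              E₄₄ * ((k₁.divisors.card : ℝ) * (k₂.divisors.card : ℝ) * (2 * (lam * Real.log M) - 2 * Real.log g - Real.log k₁ - Real.log k₂) ^ (0 : ℕ)) +
              (-1 / 896) * ((k₁.divisors.card : ℝ) * (∑ p ∈ k₁.primeFactors, Real.log p ^ (2 : ℕ)) * (k₂.divisors.card : ℝ) * (2 * (lam * Real.log M) - 2 * Real.log g - Real.log k₁ - Real.log k₂) ^ (7 : ℕ)) +
              (-E₀₀ / 64) * ((k₁.divisors.card : ℝ) * (∑ p ∈ k₁.primeFactors, Real.log p ^ (2 : ℕ)) * (k₂.divisors.card : ℝ) * (2 * (lam * Real.log M) - 2 * Real.log g - Real.log k₁ - Real.log k₂) ^ (6 : ℕ)) +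
              (-3 * E₀₁ / 32 - 3 * E₁₀ / 32 + 9 * μ₂ / 40) * ((k₁.divisors.card : ℝ) * (∑ p ∈ k₁.primeFactors, Real.log p ^ (2 : ℕ)) * (k₂.divisors.card : ℝ) * (2 * (lam * Real.log M) - 2 * Real.log g - Real.log k₁ - Real.log k₂) ^ (5 : ℕ)) +
              (-3 * E₀₂ / 32 - 3 * E₁₁ / 4 - 3 * E₂₀ / 32) * ((k₁.divisors.card : ℝ) * (∑ p ∈ k₁.primeFactors, Real.log p ^ (2 : ℕ)) * (k₂.divisors.card : ℝ) * (2 * (lam * Real.log M) - 2 * Real.log g - Real.log k₁ - Real.log k₂) ^ (4 : ℕ)) +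
              (E₀₃ / 4 - 3 * E₁₂ / 2 - 3 * E₂₁ / 2 + E₃₀ / 4 - 5 * μ₄ / 2) * ((k₁.divisors.card : ℝ) * (∑ p ∈ k₁.primeFactors, Real.log p ^ (2 : ℕ)) * (k₂.divisors.card : ℝ) * (2 * (lam * Real.log M) - 2 * Real.log g - Real.log k₁ - Real.log k₂) ^ (3 : ℕ)) +
              (3 * E₀₄ / 8 - 9 * E₂₂ / 2 + 3 * E₄₀ / 8) * ((k₁.divisors.card : ℝ) * (∑ p ∈ k₁.primeFactors, Real.log p ^ (2 : ℕ)) * (k₂.divisors.card : ℝ) * (2 * (lam * Real.log M) - 2 * Real.log g - Real.log k₁ - Real.log k₂) ^ (2 : ℕ)) +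
              (3 * E₁₄ / 2 - 3 * E₂₃ - 3 * E₃₂ + 3 * E₄₁ / 2 + 14 * μ₆) * ((k₁.divisors.card : ℝ) * (∑ p ∈ k₁.primeFactors, Real.log p ^ (2 : ℕ)) * (k₂.divisors.card : ℝ) * (2 * (lam * Real.log M) - 2 * Real.log g - Real.log k₁ - Real.log k₂) ^ (1 : ℕ)) +
              (3 * E₂₄ / 2 - 4 * E₃₃ + 3 * E₄₂ / 2) * ((k₁.divisors.card : ℝ) * (∑ p ∈ k₁.primeFactors, Real.log p ^ (2 : ℕ)) * (k₂.divisors.card : ℝ) * (2 * (lam * Real.log M) - 2 * Real.log g - Real.log k₁ - Real.log k₂) ^ (0 : ℕ)) +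
              (-1 / 896) * ((k₁.divisors.card : ℝ) * ((k₂.divisors.card : ℝ) * ∑ p ∈ k₂.primeFactors, Real.log p ^ (2 : ℕ)) * (2 * (lam * Real.log M) - 2 * Real.log g - Real.log k₁ - Real.log k₂) ^ (7 : ℕ)) +
              (-E₀₀ / 64) * ((k₁.divisors.card : ℝ) * ((k₂.divisors.card : ℝ) * ∑ p ∈ k₂.primeFactors, Real.log p ^ (2 : ℕ)) * (2 * (lam * Real.log M) - 2 * Real.log g - Real.log k₁ - Real.log k₂) ^ (6 : ℕ)) +
              (-3 * E₀₁ / 32 - 3 * E₁₀ / 32 + 9 * μ₂ / 40) * ((k₁.divisors.card : ℝ) * ((k₂.divisors.card : ℝ) * ∑ p ∈ k₂.primeFactors, Real.log p ^ (2 : ℕ)) * (2 * (lam * Real.log M) - 2 * Real.log g - Real.log k₁ - Real.log k₂) ^ (5 : ℕ)) +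
              (-3 * E₀₂ / 32 - 3 * E₁₁ / 4 - 3 * E₂₀ / 32) * ((k₁.divisors.card : ℝ) * ((k₂.divisors.card : ℝ) * ∑ p ∈ k₂.primeFactors, Real.log p ^ (2 : ℕ)) * (2 * (lam * Real.log M) - 2 * Real.log g - Real.log k₁ - Real.log k₂) ^ (4 : ℕ)) +
              (E₀₃ / 4 - 3 * E₁₂ / 2 - 3 * E₂₁ / 2 + E₃₀ / 4 - 5 * μ₄ / 2) * ((k₁.divisors.card : ℝ) * ((k₂.divisors.card : ℝ) * ∑ p ∈ k₂.primeFactors, Real.log p ^ (2 : ℕ)) * (2 * (lam * Real.log M) - 2 * Real.log g - Real.log k₁ - Real.log k₂) ^ (3 : ℕ)) +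
              (3 * E₀₄ / 8 - 9 * E₂₂ / 2 + 3 * E₄₀ / 8) * ((k₁.divisors.card : ℝ) * ((k₂.divisors.card : ℝ) * ∑ p ∈ k₂.primeFactors, Real.log p ^ (2 : ℕ)) * (2 * (lam * Real.log M) - 2 * Real.log g - Real.log k₁ - Real.log k₂) ^ (2 : ℕ)) +
              (3 * E₁₄ / 2 - 3 * E₂₃ - 3 * E₃₂ + 3 * E₄₁ / 2 + 14 * μ₆) * ((k₁.divisors.card : ℝ) * ((k₂.divisors.card : ℝ) * ∑ p ∈ k₂.primeFactors, Real.log p ^ (2 : ℕ)) * (2 * (lam * Real.log M) - 2 * Real.log g - Real.log k₁ - Real.log k₂) ^ (1 : ℕ)) +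
              (3 * E₂₄ / 2 - 4 * E₃₃ + 3 * E₄₂ / 2) * ((k₁.divisors.card : ℝ) * ((k₂.divisors.card : ℝ) * ∑ p ∈ k₂.primeFactors, Real.log p ^ (2 : ℕ)) * (2 * (lam * Real.log M) - 2 * Real.log g - Real.log k₁ - Real.log k₂) ^ (0 : ℕ)) +
              (9 / 640) * ((k₁.divisors.card : ℝ) * (∑ p ∈ k₁.primeFactors, Real.log p ^ (2 : ℕ)) * ((k₂.divisors.card : ℝ) * (∑ p ∈ k₂.primeFactors, Real.log p ^ (2 : ℕ))) * (2 * (lam * Real.log M) - 2 * Real.log g - Real.log k₁ - Real.log k₂) ^ (5 : ℕ)) +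
              (9 * E₀₀ / 64) * ((k₁.divisors.card : ℝ) * (∑ p ∈ k₁.primeFactors, Real.log p ^ (2 : ℕ)) * ((k₂.divisors.card : ℝ) * (∑ p ∈ k₂.primeFactors, Real.log p ^ (2 : ℕ))) * (2 * (lam * Real.log M) - 2 * Real.log g - Real.log k₁ - Real.log k₂) ^ (4 : ℕ)) +
              (9 * E₀₁ / 16 + 9 * E₁₀ / 16 - 15 * μ₂ / 4) * ((k₁.divisors.card : ℝ) * (∑ p ∈ k₁.primeFactors, Real.log p ^ (2 : ℕ)) * ((k₂.divisors.card : ℝ) * (∑ p ∈ k₂.primeFactors, Real.log p ^ (2 : ℕ))) * (2 * (lam * Real.log M) - 2 * Real.log g - Real.log k₁ - Real.log k₂) ^ (3 : ℕ)) +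
              (-9 * E₀₂ / 16 + 9 * E₁₁ / 2 - 9 * E₂₀ / 16) * ((k₁.divisors.card : ℝ) * (∑ p ∈ k₁.primeFactors, Real.log p ^ (2 : ℕ)) * ((k₂.divisors.card : ℝ) * (∑ p ∈ k₂.primeFactors, Real.log p ^ (2 : ℕ))) * (2 * (lam * Real.log M) - 2 * Real.log g - Real.log k₁ - Real.log k₂) ^ (2 : ℕ)) +
              (-9 * E₀₃ / 4 + 9 * E₁₂ / 2 + 9 * E₂₁ / 2 - 9 * E₃₀ / 4 + 105 * μ₄ / 2) * ((k₁.divisors.card : ℝ) * (∑ p ∈ k₁.primeFactors, Real.log p ^ (2 : ℕ)) * ((k₂.divisors.card : ℝ) * (∑ p ∈ k₂.primeFactors, Real.log p ^ (2 : ℕ))) * (2 * (lam * Real.log M) - 2 * Real.log g - Real.log k₁ - Real.log k₂) ^ (1 : ℕ)) +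
              (3 * E₀₄ / 8 - 6 * E₁₃ + 27 * E₂₂ / 2 - 6 * E₃₁ + 3 * E₄₀ / 8) * ((k₁.divisors.card : ℝ) * (∑ p ∈ k₁.primeFactors, Real.log p ^ (2 : ℕ)) * ((k₂.divisors.card : ℝ) * (∑ p ∈ k₂.primeFactors, Real.log p ^ (2 : ℕ))) * (2 * (lam * Real.log M) - 2 * Real.log g - Real.log k₁ - Real.log k₂) ^ (0 : ℕ)) +
              (3 / 1280) * ((k₁.divisors.card : ℝ) * (3 * (∑ p ∈ k₁.primeFactors, Real.log p ^ (2 : ℕ)) ^ (2 : ℕ) - 2 * ∑ p ∈ k₁.primeFactors, Real.log p ^ (4 : ℕ)) * (k₂.divisors.card : ℝ) * (2 * (lam * Real.log M) - 2 * Real.log g - Real.log k₁ - Real.log k₂) ^ (5 : ℕ)) +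
              (3 * E₀₀ / 128) * ((k₁.divisors.card : ℝ) * (3 * (∑ p ∈ k₁.primeFactors, Real.log p ^ (2 : ℕ)) ^ (2 : ℕ) - 2 * ∑ p ∈ k₁.primeFactors, Real.log p ^ (4 : ℕ)) * (k₂.divisors.card : ℝ) * (2 * (lam * Real.log M) - 2 * Real.log g - Real.log k₁ - Real.log k₂) ^ (4 : ℕ)) +
              (3 * E₀₁ / 32 + 3 * E₁₀ / 32 - 5 * μ₂ / 8) * ((k₁.divisors.card : ℝ) * (3 * (∑ p ∈ k₁.primeFactors, Real.log p ^ (2 : ℕ)) ^ (2 : ℕ) - 2 * ∑ p ∈ k₁.primeFactors, Real.log p ^ (4 : ℕ)) * (k₂.divisors.card : ℝ) * (2 * (lam * Real.log M) - 2 * Real.log g - Real.log k₁ - Real.log k₂) ^ (3 : ℕ)) +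
              (-3 * E₀₂ / 32 + 3 * E₁₁ / 4 - 3 * E₂₀ / 32) * ((k₁.divisors.card : ℝ) * (3 * (∑ p ∈ k₁.primeFactors, Real.log p ^ (2 : ℕ)) ^ (2 : ℕ) - 2 * ∑ p ∈ k₁.primeFactors, Real.log p ^ (4 : ℕ)) * (k₂.divisors.card : ℝ) * (2 * (lam * Real.log M) - 2 * Real.log g - Real.log k₁ - Real.log k₂) ^ (2 : ℕ)) +
              (-3 * E₀₃ / 8 + 3 * E₁₂ / 4 + 3 * E₂₁ / 4 - 3 * E₃₀ / 8 + 35 * μ₄ / 4) * ((k₁.divisors.card : ℝ) * (3 * (∑ p ∈ k₁.primeFactors, Real.log p ^ (2 : ℕ)) ^ (2 : ℕ) - 2 * ∑ p ∈ k₁.primeFactors, Real.log p ^ (4 : ℕ)) * (k₂.divisors.card : ℝ) * (2 * (lam * Real.log M) - 2 * Real.log g - Real.log k₁ - Real.log k₂) ^ (1 : ℕ)) +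
              (E₀₄ / 16 - E₁₃ + 9 * E₂₂ / 4 - E₃₁ + E₄₀ / 16) * ((k₁.divisors.card : ℝ) * (3 * (∑ p ∈ k₁.primeFactors, Real.log p ^ (2 : ℕ)) ^ (2 : ℕ) - 2 * ∑ p ∈ k₁.primeFactors, Real.log p ^ (4 : ℕ)) * (k₂.divisors.card : ℝ) * (2 * (lam * Real.log M) - 2 * Real.log g - Real.log k₁ - Real.log k₂) ^ (0 : ℕ)) +
              (3 / 1280) * ((k₁.divisors.card : ℝ) * ((k₂.divisors.card : ℝ) * (3 * (∑ p ∈ k₂.primeFactors, Real.log p ^ (2 : ℕ)) ^ (2 : ℕ) - 2 * ∑ p ∈ k₂.primeFactors, Real.log p ^ (4 : ℕ))) * (2 * (lam * Real.log M) - 2 * Real.log g - Real.log k₁ - Real.log k₂) ^ (5 : ℕ)) +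
              (3 * E₀₀ / 128) * ((k₁.divisors.card : ℝ) * ((k₂.divisors.card : ℝ) * (3 * (∑ p ∈ k₂.primeFactors, Real.log p ^ (2 : ℕ)) ^ (2 : ℕ) - 2 * ∑ p ∈ k₂.primeFactors, Real.log p ^ (4 : ℕ))) * (2 * (lam * Real.log M) - 2 * Real.log g - Real.log k₁ - Real.log k₂) ^ (4 : ℕ)) +
              (3 * E₀₁ / 32 + 3 * E₁₀ / 32 - 5 * μ₂ / 8) * ((k₁.divisors.card : ℝ) * ((k₂.divisors.card : ℝ) * (3 * (∑ p ∈ k₂.primeFactors, Real.log p ^ (2 : ℕ)) ^ (2 : ℕ) - 2 * ∑ p ∈ k₂.primeFactors, Real.log p ^ (4 : ℕ))) * (2 * (lam * Real.log M) - 2 * Real.log g - Real.log k₁ - Real.log k₂) ^ (3 : ℕ)) +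
              (-3 * E₀₂ / 32 + 3 * E₁₁ / 4 - 3 * E₂₀ / 32) * ((k₁.divisors.card : ℝ) * ((k₂.divisors.card : ℝ) * (3 * (∑ p ∈ k₂.primeFactors, Real.log p ^ (2 : ℕ)) ^ (2 : ℕ) - 2 * ∑ p ∈ k₂.primeFactors, Real.log p ^ (4 : ℕ))) * (2 * (lam * Real.log M) - 2 * Real.log g - Real.log k₁ - Real.log k₂) ^ (2 : ℕ)) +
              (-3 * E₀₃ / 8 + 3 * E₁₂ / 4 + 3 * E₂₁ / 4 - 3 * E₃₀ / 8 + 35 * μ₄ / 4) * ((k₁.divisors.card : ℝ) * ((k₂.divisors.card : ℝ) * (3 * (∑ p ∈ k₂.primeFactors, Real.log p ^ (2 : ℕ)) ^ (2 : ℕ) - 2 * ∑ p ∈ k₂.primeFactors, Real.log p ^ (4 : ℕ))) * (2 * (lam * Real.log M) - 2 * Real.log g - Real.log k₁ - Real.log k₂) ^ (1 : ℕ)) +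
              (E₀₄ / 16 - E₁₃ + 9 * E₂₂ / 4 - E₃₁ + E₄₀ / 16) * ((k₁.divisors.card : ℝ) * ((k₂.divisors.card : ℝ) * (3 * (∑ p ∈ k₂.primeFactors, Real.log p ^ (2 : ℕ)) ^ (2 : ℕ) - 2 * ∑ p ∈ k₂.primeFactors, Real.log p ^ (4 : ℕ))) * (2 * (lam * Real.log M) - 2 * Real.log g - Real.log k₁ - Real.log k₂) ^ (0 : ℕ)) +
              (-1 / 384) * ((k₁.divisors.card : ℝ) * (15 * (∑ p ∈ k₁.primeFactors, Real.log p ^ (2 : ℕ)) ^ (3 : ℕ) - 30 * ((∑ p ∈ k₁.primeFactors, Real.log p ^ (2 : ℕ)) * ∑ p ∈ k₁.primeFactors, Real.log p ^ (4 : ℕ)) + 16 * ∑ p ∈ k₁.primeFactors, Real.log p ^ (6 : ℕ)) * (k₂.divisors.card : ℝ) * (2 * (lam * Real.log M) - 2 * Real.log g - Real.log k₁ - Real.log k₂) ^ (3 : ℕ)) +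
              (-E₀₀ / 64) * ((k₁.divisors.card : ℝ) * (15 * (∑ p ∈ k₁.primeFactors, Real.log p ^ (2 : ℕ)) ^ (3 : ℕ) - 30 * ((∑ p ∈ k₁.primeFactors, Real.log p ^ (2 : ℕ)) * ∑ p ∈ k₁.primeFactors, Real.log p ^ (4 : ℕ)) + 16 * ∑ p ∈ k₁.primeFactors, Real.log p ^ (6 : ℕ)) * (k₂.divisors.card : ℝ) * (2 * (lam * Real.log M) - 2 * Real.log g - Real.log k₁ - Real.log k₂) ^ (2 : ℕ)) +
              (-E₀₁ / 32 - E₁₀ / 32 + 7 * μ₂ / 8) * ((k₁.divisors.card : ℝ) * (15 * (∑ p ∈ k₁.primeFactors, Real.log p ^ (2 : ℕ)) ^ (3 : ℕ) - 30 * ((∑ p ∈ k₁.primeFactors, Real.log p ^ (2 : ℕ)) * ∑ p ∈ k₁.primeFactors, Real.log p ^ (4 : ℕ)) + 16 * ∑ p ∈ k₁.primeFactors, Real.log p ^ (6 : ℕ)) * (k₂.divisors.card : ℝ) * (2 * (lam * Real.log M) - 2 * Real.log g - Real.log k₁ - Real.log k₂) ^ (1 : ℕ)) +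
              (3 * E₀₂ / 32 - E₁₁ / 4 + 3 * E₂₀ / 32) * ((k₁.divisors.card : ℝ) * (15 * (∑ p ∈ k₁.primeFactors, Real.log p ^ (2 : ℕ)) ^ (3 : ℕ) - 30 * ((∑ p ∈ k₁.primeFactors, Real.log p ^ (2 : ℕ)) * ∑ p ∈ k₁.primeFactors, Real.log p ^ (4 : ℕ)) + 16 * ∑ p ∈ k₁.primeFactors, Real.log p ^ (6 : ℕ)) * (k₂.divisors.card : ℝ) * (2 * (lam * Real.log M) - 2 * Real.log g - Real.log k₁ - Real.log k₂) ^ (0 : ℕ)) +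
              (-1 / 384) * ((k₁.divisors.card : ℝ) * ((k₂.divisors.card : ℝ) * (15 * (∑ p ∈ k₂.primeFactors, Real.log p ^ (2 : ℕ)) ^ (3 : ℕ) - 30 * ((∑ p ∈ k₂.primeFactors, Real.log p ^ (2 : ℕ)) * ∑ p ∈ k₂.primeFactors, Real.log p ^ (4 : ℕ)) + 16 * ∑ p ∈ k₂.primeFactors, Real.log p ^ (6 : ℕ))) * (2 * (lam * Real.log M) - 2 * Real.log g - Real.log k₁ - Real.log k₂) ^ (3 : ℕ)) +
              (-E₀₀ / 64) * ((k₁.divisors.card : ℝ) * ((k₂.divisors.card : ℝ) * (15 * (∑ p ∈ k₂.primeFactors, Real.log p ^ (2 : ℕ)) ^ (3 : ℕ) - 30 * ((∑ p ∈ k₂.primeFactors, Real.log p ^ (2 : ℕ)) * ∑ p ∈ k₂.primeFactors, Real.log p ^ (4 : ℕ)) + 16 * ∑ p ∈ k₂.primeFactors, Real.log p ^ (6 : ℕ))) * (2 * (lam * Real.log M) - 2 * Real.log g - Real.log k₁ - Real.log k₂) ^ (2 : ℕ)) +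
              (-E₀₁ / 32 - E₁₀ / 32 + 7 * μ₂ / 8) * ((k₁.divisors.card : ℝ) * ((k₂.divisors.card : ℝ) * (15 * (∑ p ∈ k₂.primeFactors, Real.log p ^ (2 : ℕ)) ^ (3 : ℕ) - 30 * ((∑ p ∈ k₂.primeFactors, Real.log p ^ (2 : ℕ)) * ∑ p ∈ k₂.primeFactors, Real.log p ^ (4 : ℕ)) + 16 * ∑ p ∈ k₂.primeFactors, Real.log p ^ (6 : ℕ))) * (2 * (lam * Real.log M) - 2 * Real.log g - Real.log k₁ - Real.log k₂) ^ (1 : ℕ)) +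
              (3 * E₀₂ / 32 - E₁₁ / 4 + 3 * E₂₀ / 32) * ((k₁.divisors.card : ℝ) * ((k₂.divisors.card : ℝ) * (15 * (∑ p ∈ k₂.primeFactors, Real.log p ^ (2 : ℕ)) ^ (3 : ℕ) - 30 * ((∑ p ∈ k₂.primeFactors, Real.log p ^ (2 : ℕ)) * ∑ p ∈ k₂.primeFactors, Real.log p ^ (4 : ℕ)) + 16 * ∑ p ∈ k₂.primeFactors, Real.log p ^ (6 : ℕ))) * (2 * (lam * Real.log M) - 2 * Real.log g - Real.log k₁ - Real.log k₂) ^ (0 : ℕ)) +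
              (-5 / 128) * ((k₁.divisors.card : ℝ) * (3 * (∑ p ∈ k₁.primeFactors, Real.log p ^ (2 : ℕ)) ^ (2 : ℕ) - 2 * ∑ p ∈ k₁.primeFactors, Real.log p ^ (4 : ℕ)) * ((k₂.divisors.card : ℝ) * (∑ p ∈ k₂.primeFactors, Real.log p ^ (2 : ℕ))) * (2 * (lam * Real.log M) - 2 * Real.log g - Real.log k₁ - Real.log k₂) ^ (3 : ℕ)) +
              (-15 * E₀₀ / 64) * ((k₁.divisors.card : ℝ) * (3 * (∑ p ∈ k₁.primeFactors, Real.log p ^ (2 : ℕ)) ^ (2 : ℕ) - 2 * ∑ p ∈ k₁.primeFactors, Real.log p ^ (4 : ℕ)) * ((k₂.divisors.card : ℝ) * (∑ p ∈ k₂.primeFactors, Real.log p ^ (2 : ℕ))) * (2 * (lam * Real.log M) - 2 * Real.log g - Real.log k₁ - Real.log k₂) ^ (2 : ℕ)) +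
              (-15 * E₀₁ / 32 - 15 * E₁₀ / 32 + 105 * μ₂ / 8) * ((k₁.divisors.card : ℝ) * (3 * (∑ p ∈ k₁.primeFactors, Real.log p ^ (2 : ℕ)) ^ (2 : ℕ) - 2 * ∑ p ∈ k₁.primeFactors, Real.log p ^ (4 : ℕ)) * ((k₂.divisors.card : ℝ) * (∑ p ∈ k₂.primeFactors, Real.log p ^ (2 : ℕ))) * (2 * (lam * Real.log M) - 2 * Real.log g - Real.log k₁ - Real.log k₂) ^ (1 : ℕ)) +
              (45 * E₀₂ / 32 - 15 * E₁₁ / 4 + 45 * E₂₀ / 32) * ((k₁.divisors.card : ℝ) * (3 * (∑ p ∈ k₁.primeFactors, Real.log p ^ (2 : ℕ)) ^ (2 : ℕ) - 2 * ∑ p ∈ k₁.primeFactors, Real.log p ^ (4 : ℕ)) * ((k₂.divisors.card : ℝ) * (∑ p ∈ k₂.primeFactors, Real.log p ^ (2 : ℕ))) * (2 * (lam * Real.log M) - 2 * Real.log g - Real.log k₁ - Real.log k₂) ^ (0 : ℕ)) +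
              (-5 / 128) * ((k₁.divisors.card : ℝ) * (∑ p ∈ k₁.primeFactors, Real.log p ^ (2 : ℕ)) * ((k₂.divisors.card : ℝ) * (3 * (∑ p ∈ k₂.primeFactors, Real.log p ^ (2 : ℕ)) ^ (2 : ℕ) - 2 * ∑ p ∈ k₂.primeFactors, Real.log p ^ (4 : ℕ))) * (2 * (lam * Real.log M) - 2 * Real.log g - Real.log k₁ - Real.log k₂) ^ (3 : ℕ)) +
              (-15 * E₀₀ / 64) * ((k₁.divisors.card : ℝ) * (∑ p ∈ k₁.primeFactors, Real.log p ^ (2 : ℕ)) * ((k₂.divisors.card : ℝ) * (3 * (∑ p ∈ k₂.primeFactors, Real.log p ^ (2 : ℕ)) ^ (2 : ℕ) - 2 * ∑ p ∈ k₂.primeFactors, Real.log p ^ (4 : ℕ))) * (2 * (lam * Real.log M) - 2 * Real.log g - Real.log k₁ - Real.log k₂) ^ (2 : ℕ)) +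
              (-15 * E₀₁ / 32 - 15 * E₁₀ / 32 + 105 * μ₂ / 8) * ((k₁.divisors.card : ℝ) * (∑ p ∈ k₁.primeFactors, Real.log p ^ (2 : ℕ)) * ((k₂.divisors.card : ℝ) * (3 * (∑ p ∈ k₂.primeFactors, Real.log p ^ (2 : ℕ)) ^ (2 : ℕ) - 2 * ∑ p ∈ k₂.primeFactors, Real.log p ^ (4 : ℕ))) * (2 * (lam * Real.log M) - 2 * Real.log g - Real.log k₁ - Real.log k₂) ^ (1 : ℕ)) +
              (45 * E₀₂ / 32 - 15 * E₁₁ / 4 + 45 * E₂₀ / 32) * ((k₁.divisors.card : ℝ) * (∑ p ∈ k₁.primeFactors, Real.log p ^ (2 : ℕ)) * ((k₂.divisors.card : ℝ) * (3 * (∑ p ∈ k₂.primeFactors, Real.log p ^ (2 : ℕ)) ^ (2 : ℕ) - 2 * ∑ p ∈ k₂.primeFactors, Real.log p ^ (4 : ℕ))) * (2 * (lam * Real.log M) - 2 * Real.log g - Real.log k₁ - Real.log k₂) ^ (0 : ℕ)) +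
              (1 / 512) * ((k₁.divisors.card : ℝ) * (105 * (∑ p ∈ k₁.primeFactors, Real.log p ^ (2 : ℕ)) ^ (4 : ℕ) - 420 * (∑ p ∈ k₁.primeFactors, Real.log p ^ (2 : ℕ)) ^ (2 : ℕ) * (∑ p ∈ k₁.primeFactors, Real.log p ^ (4 : ℕ)) + 448 * (∑ p ∈ k₁.primeFactors, Real.log p ^ (2 : ℕ)) * (∑ p ∈ k₁.primeFactors, Real.log p ^ (6 : ℕ)) + 140 * (∑ p ∈ k₁.primeFactors, Real.log p ^ (4 : ℕ)) ^ (2 : ℕ) - 272 * ∑ p ∈ k₁.primeFactors, Real.log p ^ (8 : ℕ)) * (k₂.divisors.card : ℝ) * (2 * (lam * Real.log M) - 2 * Real.log g - Real.log k₁ - Real.log k₂) ^ (1 : ℕ)) +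
              (E₀₀ / 256) * ((k₁.divisors.card : ℝ) * (105 * (∑ p ∈ k₁.primeFactors, Real.log p ^ (2 : ℕ)) ^ (4 : ℕ) - 420 * (∑ p ∈ k₁.primeFactors, Real.log p ^ (2 : ℕ)) ^ (2 : ℕ) * (∑ p ∈ k₁.primeFactors, Real.log p ^ (4 : ℕ)) + 448 * (∑ p ∈ k₁.primeFactors, Real.log p ^ (2 : ℕ)) * (∑ p ∈ k₁.primeFactors, Real.log p ^ (6 : ℕ)) + 140 * (∑ p ∈ k₁.primeFactors, Real.log p ^ (4 : ℕ)) ^ (2 : ℕ) - 272 * ∑ p ∈ k₁.primeFactors, Real.log p ^ (8 : ℕ)) * (k₂.divisors.card : ℝ) * (2 * (lam * Real.log M) - 2 * Real.log g - Real.log k₁ - Real.log k₂) ^ (0 : ℕ)) +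
              (1 / 512) * ((k₁.divisors.card : ℝ) * ((k₂.divisors.card : ℝ) * (105 * (∑ p ∈ k₂.primeFactors, Real.log p ^ (2 : ℕ)) ^ (4 : ℕ) - 420 * (∑ p ∈ k₂.primeFactors, Real.log p ^ (2 : ℕ)) ^ (2 : ℕ) * (∑ p ∈ k₂.primeFactors, Real.log p ^ (4 : ℕ)) + 448 * (∑ p ∈ k₂.primeFactors, Real.log p ^ (2 : ℕ)) * (∑ p ∈ k₂.primeFactors, Real.log p ^ (6 : ℕ)) + 140 * (∑ p ∈ k₂.primeFactors, Real.log p ^ (4 : ℕ)) ^ (2 : ℕ) - 272 * ∑ p ∈ k₂.primeFactors, Real.log p ^ (8 : ℕ))) * (2 * (lam * Real.log M) - 2 * Real.log g - Real.log k₁ - Real.log k₂) ^ (1 : ℕ)) +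
              (E₀₀ / 256) * ((k₁.divisors.card : ℝ) * ((k₂.divisors.card : ℝ) * (105 * (∑ p ∈ k₂.primeFactors, Real.log p ^ (2 : ℕ)) ^ (4 : ℕ) - 420 * (∑ p ∈ k₂.primeFactors, Real.log p ^ (2 : ℕ)) ^ (2 : ℕ) * (∑ p ∈ k₂.primeFactors, Real.log p ^ (4 : ℕ)) + 448 * (∑ p ∈ k₂.primeFactors, Real.log p ^ (2 : ℕ)) * (∑ p ∈ k₂.primeFactors, Real.log p ^ (6 : ℕ)) + 140 * (∑ p ∈ k₂.primeFactors, Real.log p ^ (4 : ℕ)) ^ (2 : ℕ) - 272 * ∑ p ∈ k₂.primeFactors, Real.log p ^ (8 : ℕ))) * (2 * (lam * Real.log M) - 2 * Real.log g - Real.log k₁ - Real.log k₂) ^ (0 : ℕ)) +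
              (7 / 128) * ((k₁.divisors.card : ℝ) * (15 * (∑ p ∈ k₁.primeFactors, Real.log p ^ (2 : ℕ)) ^ (3 : ℕ) - 30 * ((∑ p ∈ k₁.primeFactors, Real.log p ^ (2 : ℕ)) * ∑ p ∈ k₁.primeFactors, Real.log p ^ (4 : ℕ)) + 16 * ∑ p ∈ k₁.primeFactors, Real.log p ^ (6 : ℕ)) * ((k₂.divisors.card : ℝ) * (∑ p ∈ k₂.primeFactors, Real.log p ^ (2 : ℕ))) * (2 * (lam * Real.log M) - 2 * Real.log g - Real.log k₁ - Real.log k₂) ^ (1 : ℕ)) +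
              (7 * E₀₀ / 64) * ((k₁.divisors.card : ℝ) * (15 * (∑ p ∈ k₁.primeFactors, Real.log p ^ (2 : ℕ)) ^ (3 : ℕ) - 30 * ((∑ p ∈ k₁.primeFactors, Real.log p ^ (2 : ℕ)) * ∑ p ∈ k₁.primeFactors, Real.log p ^ (4 : ℕ)) + 16 * ∑ p ∈ k₁.primeFactors, Real.log p ^ (6 : ℕ)) * ((k₂.divisors.card : ℝ) * (∑ p ∈ k₂.primeFactors, Real.log p ^ (2 : ℕ))) * (2 * (lam * Real.log M) - 2 * Real.log g - Real.log k₁ - Real.log k₂) ^ (0 : ℕ)) +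
              (7 / 128) * ((k₁.divisors.card : ℝ) * (∑ p ∈ k₁.primeFactors, Real.log p ^ (2 : ℕ)) * ((k₂.divisors.card : ℝ) * (15 * (∑ p ∈ k₂.primeFactors, Real.log p ^ (2 : ℕ)) ^ (3 : ℕ) - 30 * ((∑ p ∈ k₂.primeFactors, Real.log p ^ (2 : ℕ)) * ∑ p ∈ k₂.primeFactors, Real.log p ^ (4 : ℕ)) + 16 * ∑ p ∈ k₂.primeFactors, Real.log p ^ (6 : ℕ))) * (2 * (lam * Real.log M) - 2 * Real.log g - Real.log k₁ - Real.log k₂) ^ (1 : ℕ)) +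
              (7 * E₀₀ / 64) * ((k₁.divisors.card : ℝ) * (∑ p ∈ k₁.primeFactors, Real.log p ^ (2 : ℕ)) * ((k₂.divisors.card : ℝ) * (15 * (∑ p ∈ k₂.primeFactors, Real.log p ^ (2 : ℕ)) ^ (3 : ℕ) - 30 * ((∑ p ∈ k₂.primeFactors, Real.log p ^ (2 : ℕ)) * ∑ p ∈ k₂.primeFactors, Real.log p ^ (4 : ℕ)) + 16 * ∑ p ∈ k₂.primeFactors, Real.log p ^ (6 : ℕ))) * (2 * (lam * Real.log M) - 2 * Real.log g - Real.log k₁ - Real.log k₂) ^ (0 : ℕ)) +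
              (35 / 256) * ((k₁.divisors.card : ℝ) * (3 * (∑ p ∈ k₁.primeFactors, Real.log p ^ (2 : ℕ)) ^ (2 : ℕ) - 2 * ∑ p ∈ k₁.primeFactors, Real.log p ^ (4 : ℕ)) * ((k₂.divisors.card : ℝ) * (3 * (∑ p ∈ k₂.primeFactors, Real.log p ^ (2 : ℕ)) ^ (2 : ℕ) - 2 * ∑ p ∈ k₂.primeFactors, Real.log p ^ (4 : ℕ))) * (2 * (lam * Real.log M) - 2 * Real.log g - Real.log k₁ - Real.log k₂) ^ (1 : ℕ)) +
              (35 * E₀₀ / 128) * ((k₁.divisors.card : ℝ) * (3 * (∑ p ∈ k₁.primeFactors, Real.log p ^ (2 : ℕ)) ^ (2 : ℕ) - 2 * ∑ p ∈ k₁.primeFactors, Real.log p ^ (4 : ℕ)) * ((k₂.divisors.card : ℝ) * (3 * (∑ p ∈ k₂.primeFactors, Real.log p ^ (2 : ℕ)) ^ (2 : ℕ) - 2 * ∑ p ∈ k₂.primeFactors, Real.log p ^ (4 : ℕ))) * (2 * (lam * Real.log M) - 2 * Real.log g - Real.log k₁ - Real.log k₂) ^ (0 : ℕ))) -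
        (π ^ (2 : ℕ) / 6) ^ (2 : ℕ) * ((1 / 4608) * (∑ j ∈ Finset.range (9 + 1), ∑ i ∈ Finset.range (j + 1),
            ((9 : ℕ).choose j : ℝ) * (j.choose i : ℝ) * 2 ^ (9 - j) *
              ∫ u in (0 : ℝ)..1, (((Polynomial.C lam - X) ^ (9 - j) * derivative (derivative (X ^ i * P))) *
                derivative (derivative (X ^ (j - i) * P))).eval u) +
          (-1 / 448) * (∑ j ∈ Finset.range (7 + 1), ∑ i ∈ Finset.range (j + 1),
            ((7 : ℕ).choose j : ℝ) * (j.choose i : ℝ) * 2 ^ (7 - j) *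
              ∫ u in (0 : ℝ)..1, (((Polynomial.C lam - X) ^ (7 - j) * (-(2 : ℝ) • (X ^ i * P))) *
                derivative (derivative (X ^ (j - i) * P))).eval u) +
          (9 / 640) * (∑ j ∈ Finset.range (5 + 1), ∑ i ∈ Finset.range (j + 1),
            ((5 : ℕ).choose j : ℝ) * (j.choose i : ℝ) * 2 ^ (5 - j) *
              ∫ u in (0 : ℝ)..1, (((Polynomial.C lam - X) ^ (5 - j) * (-(2 : ℝ) • (X ^ i * P))) *
                (-(2 : ℝ) • (X ^ (j - i) * P))).eval u)) * Real.log M ^ (6 : ℕ)| ≤ C * Real.log M ^ (5 : ℕ) := by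
  obtain ⟨C₉, hC₉, h9⟩ := abs_selbergLpow_sub_le P hP0 hP1 9 hlam0 hlam1
  obtain ⟨C₈, hC₈, h8⟩ := abs_selbergLpow_sub_le P hP0 hP1 8 hlam0 hlam1
  obtain ⟨C₇, hC₇, h7⟩ := abs_selbergLpow_sub_le P hP0 hP1 7 hlam0 hlam1
  obtain ⟨C₆, hC₆, h6⟩ := abs_selbergLpow_sub_le P hP0 hP1 6 hlam0 hlam1
  obtain ⟨C₅, hC₅, h5⟩ := abs_selbergLpow_sub_le P hP0 hP1 5 hlam0 hlam1
  obtain ⟨C₄, hC₄, h4⟩ := abs_selbergLpow_sub_le P hP0 hP1 4 hlam0 hlam1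
  obtain ⟨C₃, hC₃, h3⟩ := abs_selbergLpow_sub_le P hP0 hP1 3 hlam0 hlam1
  obtain ⟨C₂, hC₂, h2⟩ := abs_selbergLpow_sub_le P hP0 hP1 2 hlam0 hlam1
  obtain ⟨C₁, hC₁, h1⟩ := abs_selbergLpow_sub_le P hP0 hP1 1 hlam0 hlam1
  obtain ⟨C₀, hC₀, h0⟩ := abs_selbergLpow_sub_le P hP0 hP1 0 hlam0 hlam1
  obtain ⟨D₇, hD₇, g7⟩ := abs_selbergP2Lpow_sub_le P hP0 hP1 7 hlam0 hlam1
  obtain ⟨D₆, hD₆, g6⟩ := abs_selbergP2Lpow_sub_le P hP0 hP1 6 hlam0 hlam1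
  obtain ⟨D₅, hD₅, g5⟩ := abs_selbergP2Lpow_sub_le P hP0 hP1 5 hlam0 hlam1
  obtain ⟨D₄, hD₄, g4⟩ := abs_selbergP2Lpow_sub_le P hP0 hP1 4 hlam0 hlam1
  obtain ⟨D₃, hD₃, g3⟩ := abs_selbergP2Lpow_sub_le P hP0 hP1 3 hlam0 hlam1
  obtain ⟨D₂, hD₂, g2⟩ := abs_selbergP2Lpow_sub_le P hP0 hP1 2 hlam0 hlam1
  obtain ⟨D₁, hD₁, g1⟩ := abs_selbergP2Lpow_sub_le P hP0 hP1 1 hlam0 hlam1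
  obtain ⟨D₀, hD₀, g0⟩ := abs_selbergP2Lpow_sub_le P hP0 hP1 0 hlam0 hlam1
  obtain ⟨D₇', hD₇', g7p⟩ := abs_selbergP2Lpow_sub_le' P hP0 hP1 7 hlam0 hlam1
  obtain ⟨D₆', hD₆', g6p⟩ := abs_selbergP2Lpow_sub_le' P hP0 hP1 6 hlam0 hlam1
  obtain ⟨D₅', hD₅', g5p⟩ := abs_selbergP2Lpow_sub_le' P hP0 hP1 5 hlam0 hlam1
  obtain ⟨D₄', hD₄', g4p⟩ := abs_selbergP2Lpow_sub_le' P hP0 hP1 4 hlam0 hlam1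
  obtain ⟨D₃', hD₃', g3p⟩ := abs_selbergP2Lpow_sub_le' P hP0 hP1 3 hlam0 hlam1
  obtain ⟨D₂', hD₂', g2p⟩ := abs_selbergP2Lpow_sub_le' P hP0 hP1 2 hlam0 hlam1
  obtain ⟨D₁', hD₁', g1p⟩ := abs_selbergP2Lpow_sub_le' P hP0 hP1 1 hlam0 hlam1
  obtain ⟨D₀', hD₀', g0p⟩ := abs_selbergP2Lpow_sub_le' P hP0 hP1 0 hlam0 hlam1
  obtain ⟨G₅, hG₅, u5⟩ := abs_selbergP2P2Lpow_sub_le P hP0 hP1 5 hlam0 hlam1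
  obtain ⟨G₄, hG₄, u4⟩ := abs_selbergP2P2Lpow_sub_le P hP0 hP1 4 hlam0 hlam1
  obtain ⟨G₃, hG₃, u3⟩ := abs_selbergP2P2Lpow_sub_le P hP0 hP1 3 hlam0 hlam1
  obtain ⟨G₂, hG₂, u2⟩ := abs_selbergP2P2Lpow_sub_le P hP0 hP1 2 hlam0 hlam1
  obtain ⟨G₁, hG₁, u1⟩ := abs_selbergP2P2Lpow_sub_le P hP0 hP1 1 hlam0 hlam1
  obtain ⟨G₀, hG₀, u0⟩ := abs_selbergP2P2Lpow_sub_le P hP0 hP1 0 hlam0 hlam1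
  obtain ⟨A₅, -, v5⟩ := abs_selbergM4Lpow_le P hP0 hP1 5 hlam0 hlam1
  obtain ⟨A₄, -, v4⟩ := abs_selbergM4Lpow_le P hP0 hP1 4 hlam0 hlam1
  obtain ⟨A₃, -, v3⟩ := abs_selbergM4Lpow_le P hP0 hP1 3 hlam0 hlam1
  obtain ⟨A₂, -, v2⟩ := abs_selbergM4Lpow_le P hP0 hP1 2 hlam0 hlam1
  obtain ⟨A₁, -, v1⟩ := abs_selbergM4Lpow_le P hP0 hP1 1 hlam0 hlam1
  obtain ⟨A₀, -, v0⟩ := abs_selbergM4Lpow_le P hP0 hP1 0 hlam0 hlam1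
  obtain ⟨B₅, -, w5⟩ := abs_selbergM4Lpow_le' P hP0 hP1 5 hlam0 hlam1
  obtain ⟨B₄, -, w4⟩ := abs_selbergM4Lpow_le' P hP0 hP1 4 hlam0 hlam1
  obtain ⟨B₃, -, w3⟩ := abs_selbergM4Lpow_le' P hP0 hP1 3 hlam0 hlam1
  obtain ⟨B₂, -, w2⟩ := abs_selbergM4Lpow_le' P hP0 hP1 2 hlam0 hlam1
  obtain ⟨B₁, -, w1⟩ := abs_selbergM4Lpow_le' P hP0 hP1 1 hlam0 hlam1
  obtain ⟨B₀, -, w0⟩ := abs_selbergM4Lpow_le' P hP0 hP1 0 hlam0 hlam1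
  obtain ⟨CY₃, -, y3⟩ := abs_selbergM6Lpow_le P hP0 hP1 3 hlam0 hlam1
  obtain ⟨CY₂, -, y2⟩ := abs_selbergM6Lpow_le P hP0 hP1 2 hlam0 hlam1
  obtain ⟨CY₁, -, y1⟩ := abs_selbergM6Lpow_le P hP0 hP1 1 hlam0 hlam1
  obtain ⟨CY₀, -, y0⟩ := abs_selbergM6Lpow_le P hP0 hP1 0 hlam0 hlam1
  obtain ⟨CZ₃, -, z3⟩ := abs_selbergM6Lpow_le' P hP0 hP1 3 hlam0 hlam1
  obtain ⟨CZ₂, -, z2⟩ := abs_selbergM6Lpow_le' P hP0 hP1 2 hlam0 hlam1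
  obtain ⟨CZ₁, -, z1⟩ := abs_selbergM6Lpow_le' P hP0 hP1 1 hlam0 hlam1
  obtain ⟨CZ₀, -, z0⟩ := abs_selbergM6Lpow_le' P hP0 hP1 0 hlam0 hlam1
  obtain ⟨CR₃, -, r3⟩ := abs_selbergM4P2Lpow_le P hP0 hP1 3 hlam0 hlam1
  obtain ⟨CR₂, -, r2⟩ := abs_selbergM4P2Lpow_le P hP0 hP1 2 hlam0 hlam1
  obtain ⟨CR₁, -, r1⟩ := abs_selbergM4P2Lpow_le P hP0 hP1 1 hlam0 hlam1
  obtain ⟨CR₀, -, r0⟩ := abs_selbergM4P2Lpow_le P hP0 hP1 0 hlam0 hlam1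
  obtain ⟨CR₃', -, r3p⟩ := abs_selbergM4P2Lpow_le' P hP0 hP1 3 hlam0 hlam1
  obtain ⟨CR₂', -, r2p⟩ := abs_selbergM4P2Lpow_le' P hP0 hP1 2 hlam0 hlam1
  obtain ⟨CR₁', -, r1p⟩ := abs_selbergM4P2Lpow_le' P hP0 hP1 1 hlam0 hlam1
  obtain ⟨CR₀', -, r0p⟩ := abs_selbergM4P2Lpow_le' P hP0 hP1 0 hlam0 hlam1
  obtain ⟨CN₁, -, n1⟩ := abs_selbergM8Lpow_le P hP0 hP1 1 hlam0 hlam1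
  obtain ⟨CN₀, -, n0⟩ := abs_selbergM8Lpow_le P hP0 hP1 0 hlam0 hlam1
  obtain ⟨CN₁', -, n1p⟩ := abs_selbergM8Lpow_le' P hP0 hP1 1 hlam0 hlam1
  obtain ⟨CN₀', -, n0p⟩ := abs_selbergM8Lpow_le' P hP0 hP1 0 hlam0 hlam1
  obtain ⟨CX₁, -, x1⟩ := abs_selbergM6P2Lpow_le P hP0 hP1 1 hlam0 hlam1
  obtain ⟨CX₀, -, x0⟩ := abs_selbergM6P2Lpow_le P hP0 hP1 0 hlam0 hlam1
  obtain ⟨CX₁', -, x1p⟩ := abs_selbergM6P2Lpow_le' P hP0 hP1 1 hlam0 hlam1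
  obtain ⟨CX₀', -, x0p⟩ := abs_selbergM6P2Lpow_le' P hP0 hP1 0 hlam0 hlam1
  obtain ⟨CO₁, -, o1⟩ := abs_selbergM4M4Lpow_le P hP0 hP1 1 hlam0 hlam1
  obtain ⟨CO₀, -, o0⟩ := abs_selbergM4M4Lpow_le P hP0 hP1 0 hlam0 hlam1
  have hK : 0 ≤ (π ^ 2 / 6 : ℝ) ^ 2 := by positivity
  refine ⟨?_, fun M hM ↦ ?_⟩
  swap
  · have hℓ1 : 1 ≤ Real.log M := one_le_log_of_three_le hM
    simp (config := { maxSteps := 4000000 }) only [selbergProd_add, selbergProd_const_mul]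
    exact orderFourFour_combine (E₀₀ := E₀₀) (E₀₁ := E₀₁) (E₀₂ := E₀₂) (E₀₃ := E₀₃) (E₀₄ := E₀₄) (E₁₀ := E₁₀) (E₁₁ := E₁₁) (E₁₂ := E₁₂) (E₁₃ := E₁₃) (E₁₄ := E₁₄) (E₂₀ := E₂₀) (E₂₁ := E₂₁) (E₂₂ := E₂₂) (E₂₃ := E₂₃) (E₂₄ := E₂₄) (E₃₀ := E₃₀) (E₃₁ := E₃₁) (E₃₂ := E₃₂) (E₃₃ := E₃₃) (E₃₄ := E₃₄) (E₄₀ := E₄₀) (E₄₁ := E₄₁) (E₄₂ := E₄₂) (E₄₃ := E₄₃) (E₄₄ := E₄₄) (μ₂ := μ₂) (μ₄ := μ₄) (μ₆ := μ₆) (μ₈ := μ₈) hℓ1 hK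
      hC₈.le hC₇.le hC₆.le hC₅.le hC₄.le hC₃.le hC₂.le hC₁.le hC₀.le hD₆.le hD₅.le hD₄.le hD₃.le hD₂.le hD₁.le hD₀.le hD₆'.le hD₅'.le hD₄'.le hD₃'.le hD₂'.le hD₁'.le hD₀'.le hG₄.le hG₃.le hG₂.le hG₁.le hG₀.le
      (h9 M hM) (h8 M hM) (h7 M hM) (h6 M hM) (h5 M hM) (h4 M hM) (h3 M hM) (h2 M hM) (h1 M hM) (h0 M hM) (g7 M hM) (g6 M hM) (g5 M hM) (g4 M hM) (g3 M hM) (g2 M hM) (g1 M hM) (g0 M hM) (g7p M hM) (g6p M hM) (g5p M hM) (g4p M hM) (g3p M hM) (g2p M hM) (g1p M hM) (g0p M hM) (u5 M hM) (u4 M hM) (u3 M hM) (u2 M hM) (u1 M hM) (u0 M hM) (v5 M hM) (v4 M hM) (v3 M hM) (v2 M hM) (v1 M hM) (v0 M hM) (w5 M hM) (w4 M hM) (w3 M hM) (w2 M hM) (w1 M hM) (w0 M hM) (y3 M hM) (y2 M hM) (y1 M hM) (y0 M hM) (z3 M hM) (z2 M hM) (z1 M hM) (z0 M hM) (r3 M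 hM) (r2 M hM) (r1 M hM) (r0 M hM) (r3p M hM) (r2p M hM) (r1p M hM) (r0p M hM) (n1 M hM) (n0 M hM) (n1p M hM) (n0p M hM) (x1 M hM) (x0 M hM) (x1p M hM) (x0p M hM) (o1 M hM) (o0 M hM)

set_option maxHeartbeats 4000000 in
set_option maxRecDepth 16384 in
-- large statement
/-- **(Poly₄₄) in the exact hypothesis shape of `…DiagDecorOrderFourFourAssembly.orderFourFour_target_of_poly_of_remainder`**
(`𝔎₄₄(λ,P) = (π²/6)²(Φ₉/4608 − Ψ₇/448 + 9Ξ₅/640)`), for every `P` with `P₀ = P₁ = 0` and every `λ ∈ [0,1]`.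
[cite: KowalskiMichelVanderKam2000, (23)–(28) and Prop. 5.1 — derivation] -/
theorem orderFourFourPoly :
    ∀ P : ℝ[X], P.coeff 0 = 0 → P.coeff 1 = 0 → ∀ lam : ℝ, 0 ≤ lam → lam ≤ 1 →
      ∀ E₀₀ E₀₁ E₀₂ E₀₃ E₀₄ E₁₀ E₁₁ E₁₂ E₁₃ E₁₄ E₂₀ E₂₁ E₂₂ E₂₃ E₂₄ E₃₀ E₃₁ E₃₂ E₃₃ E₃₄ E₄₀ E₄₁ E₄₂ E₄₃ E₄₄ μ₂ μ₄ μ₆ μ₈ : ℝ, ∃ C : ℝ, ∀ M : ℝ, 3 ≤ M →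
      |∑ c ∈ Icc 1 ⌊M⌋₊, ∑ g ∈ Icc 1 (⌊M⌋₊ / c), (μ g : ℝ) * c *
        ∑ k₁ ∈ Icc 1 (⌊M⌋₊ / (c * g)), ∑ k₂ ∈ Icc 1 (⌊M⌋₊ / (c * g)),
          ((μ (c * g * k₁) : ℝ) * ((psi (c * g * k₁))⁻¹ *
              P.eval (Real.log (M / ((c * g * k₁ : ℕ) : ℝ)) / Real.log M)) / ((c * g * k₁ : ℕ) : ℝ)) *
            ((μ (c * g * k₂) : ℝ) * ((psi (c * g * k₂))⁻¹ *
              P.eval (Real.log (M / ((c * g * k₂ : ℕ) : ℝ)) / Real.log M)) / ((c * g * k₂ : ℕ) : ℝ)) *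
            ((1 / 4608) * ((k₁.divisors.card : ℝ) * (k₂.divisors.card : ℝ) * (2 * (lam * Real.log M) - 2 * Real.log g - Real.log k₁ - Real.log k₂) ^ (9 : ℕ)) +
              (E₀₀ / 256) * ((k₁.divisors.card : ℝ) * (k₂.divisors.card : ℝ) * (2 * (lam * Real.log M) - 2 * Real.log g - Real.log k₁ - Real.log k₂) ^ (8 : ℕ)) +
              (E₀₁ / 32 + E₁₀ / 32 - μ₂ / 56) * ((k₁.divisors.card : ℝ) * (k₂.divisors.card : ℝ) * (2 * (lam * Real.log M) - 2 * Real.log g - Real.log k₁ - Real.log k₂) ^ (7 : ℕ)) +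
              (3 * E₀₂ / 32 + E₁₁ / 4 + 3 * E₂₀ / 32) * ((k₁.divisors.card : ℝ) * (k₂.divisors.card : ℝ) * (2 * (lam * Real.log M) - 2 * Real.log g - Real.log k₁ - Real.log k₂) ^ (6 : ℕ)) +
              (E₀₃ / 8 + 3 * E₁₂ / 4 + 3 * E₂₁ / 4 + E₃₀ / 8 + 3 * μ₄ / 20) * ((k₁.divisors.card : ℝ) * (k₂.divisors.card : ℝ) * (2 * (lam * Real.log M) - 2 * Real.log g - Real.log k₁ - Real.log k₂) ^ (5 : ℕ)) +
              (E₀₄ / 16 + E₁₃ + 9 * E₂₂ / 4 + E₃₁ + E₄₀ / 16) * ((k₁.divisors.card : ℝ) * (k₂.divisors.card : ℝ) * (2 * (lam * Real.log M) - 2 * Real.log g - Real.log k₁ - Real.log k₂) ^ (4 : ℕ)) +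
              (E₁₄ / 2 + 3 * E₂₃ + 3 * E₃₂ + E₄₁ / 2 - 2 * μ₆ / 3) * ((k₁.divisors.card : ℝ) * (k₂.divisors.card : ℝ) * (2 * (lam * Real.log M) - 2 * Real.log g - Real.log k₁ - Real.log k₂) ^ (3 : ℕ)) +
              (3 * E₂₄ / 2 + 4 * E₃₃ + 3 * E₄₂ / 2) * ((k₁.divisors.card : ℝ) * (k₂.divisors.card : ℝ) * (2 * (lam * Real.log M) - 2 * Real.log g - Real.log k₁ - Real.log k₂) ^ (2 : ℕ)) +
              (2 * E₃₄ + 2 * E₄₃ + 2 * μ₈) * ((k₁.divisors.card : ℝ) * (k₂.divisors.card : ℝ) * (2 * (lam * Real.log M) - 2 * Real.log g - Real.log k₁ - Real.log k₂) ^ (1 : ℕ)) +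
              E₄₄ * ((k₁.divisors.card : ℝ) * (k₂.divisors.card : ℝ) * (2 * (lam * Real.log M) - 2 * Real.log g - Real.log k₁ - Real.log k₂) ^ (0 : ℕ)) +
              (-1 / 896) * ((k₁.divisors.card : ℝ) * (∑ p ∈ k₁.primeFactors, Real.log p ^ (2 : ℕ)) * (k₂.divisors.card : ℝ) * (2 * (lam * Real.log M) - 2 * Real.log g - Real.log k₁ - Real.log k₂) ^ (7 : ℕ)) +
              (-E₀₀ / 64) * ((k₁.divisors.card : ℝ) * (∑ p ∈ k₁.primeFactors, Real.log p ^ (2 : ℕ)) * (k₂.divisors.card : ℝ) * (2 * (lam * Real.log M) - 2 * Real.log g - Real.log k₁ - Real.log k₂) ^ (6 : ℕ)) +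
              (-3 * E₀₁ / 32 - 3 * E₁₀ / 32 + 9 * μ₂ / 40) * ((k₁.divisors.card : ℝ) * (∑ p ∈ k₁.primeFactors, Real.log p ^ (2 : ℕ)) * (k₂.divisors.card : ℝ) * (2 * (lam * Real.log M) - 2 * Real.log g - Real.log k₁ - Real.log k₂) ^ (5 : ℕ)) +
              (-3 * E₀₂ / 32 - 3 * E₁₁ / 4 - 3 * E₂₀ / 32) * ((k₁.divisors.card : ℝ) * (∑ p ∈ k₁.primeFactors, Real.log p ^ (2 : ℕ)) * (k₂.divisors.card : ℝ) * (2 * (lam * Real.log M) - 2 * Real.log g - Real.log k₁ - Real.log k₂) ^ (4 : ℕ)) +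
              (E₀₃ / 4 - 3 * E₁₂ / 2 - 3 * E₂₁ / 2 + E₃₀ / 4 - 5 * μ₄ / 2) * ((k₁.divisors.card : ℝ) * (∑ p ∈ k₁.primeFactors, Real.log p ^ (2 : ℕ)) * (k₂.divisors.card : ℝ) * (2 * (lam * Real.log M) - 2 * Real.log g - Real.log k₁ - Real.log k₂) ^ (3 : ℕ)) +
              (3 * E₀₄ / 8 - 9 * E₂₂ / 2 + 3 * E₄₀ / 8) * ((k₁.divisors.card : ℝ) * (∑ p ∈ k₁.primeFactors, Real.log p ^ (2 : ℕ)) * (k₂.divisors.card : ℝ) * (2 * (lam * Real.log M) - 2 * Real.log g - Real.log k₁ - Real.log k₂) ^ (2 : ℕ)) +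
              (3 * E₁₄ / 2 - 3 * E₂₃ - 3 * E₃₂ + 3 * E₄₁ / 2 + 14 * μ₆) * ((k₁.divisors.card : ℝ) * (∑ p ∈ k₁.primeFactors, Real.log p ^ (2 : ℕ)) * (k₂.divisors.card : ℝ) * (2 * (lam * Real.log M) - 2 * Real.log g - Real.log k₁ - Real.log k₂) ^ (1 : ℕ)) +
              (3 * E₂₄ / 2 - 4 * E₃₃ + 3 * E₄₂ / 2) * ((k₁.divisors.card : ℝ) * (∑ p ∈ k₁.primeFactors, Real.log p ^ (2 : ℕ)) * (k₂.divisors.card : ℝ) * (2 * (lam * Real.log M) - 2 * Real.log g - Real.log k₁ - Real.log k₂) ^ (0 : ℕ)) +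
              (-1 / 896) * ((k₁.divisors.card : ℝ) * ((k₂.divisors.card : ℝ) * ∑ p ∈ k₂.primeFactors, Real.log p ^ (2 : ℕ)) * (2 * (lam * Real.log M) - 2 * Real.log g - Real.log k₁ - Real.log k₂) ^ (7 : ℕ)) +
              (-E₀₀ / 64) * ((k₁.divisors.card : ℝ) * ((k₂.divisors.card : ℝ) * ∑ p ∈ k₂.primeFactors, Real.log p ^ (2 : ℕ)) * (2 * (lam * Real.log M) - 2 * Real.log g - Real.log k₁ - Real.log k₂) ^ (6 : ℕ)) +
              (-3 * E₀₁ / 32 - 3 * E₁₀ / 32 + 9 * μ₂ / 40) * ((k₁.divisors.card : ℝ) * ((k₂.divisors.card : ℝ) * ∑ p ∈ k₂.primeFactors, Real.log p ^ (2 : ℕ)) * (2 * (lam * Real.log M) - 2 * Real.log g - Real.log k₁ - Real.log k₂) ^ (5 : ℕ)) +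
              (-3 * E₀₂ / 32 - 3 * E₁₁ / 4 - 3 * E₂₀ / 32) * ((k₁.divisors.card : ℝ) * ((k₂.divisors.card : ℝ) * ∑ p ∈ k₂.primeFactors, Real.log p ^ (2 : ℕ)) * (2 * (lam * Real.log M) - 2 * Real.log g - Real.log k₁ - Real.log k₂) ^ (4 : ℕ)) +
              (E₀₃ / 4 - 3 * E₁₂ / 2 - 3 * E₂₁ / 2 + E₃₀ / 4 - 5 * μ₄ / 2) * ((k₁.divisors.card : ℝ) * ((k₂.divisors.card : ℝ) * ∑ p ∈ k₂.primeFactors, Real.log p ^ (2 : ℕ)) * (2 * (lam * Real.log M) - 2 * Real.log g - Real.log k₁ - Real.log k₂) ^ (3 : ℕ)) +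
              (3 * E₀₄ / 8 - 9 * E₂₂ / 2 + 3 * E₄₀ / 8) * ((k₁.divisors.card : ℝ) * ((k₂.divisors.card : ℝ) * ∑ p ∈ k₂.primeFactors, Real.log p ^ (2 : ℕ)) * (2 * (lam * Real.log M) - 2 * Real.log g - Real.log k₁ - Real.log k₂) ^ (2 : ℕ)) +
              (3 * E₁₄ / 2 - 3 * E₂₃ - 3 * E₃₂ + 3 * E₄₁ / 2 + 14 * μ₆) * ((k₁.divisors.card : ℝ) * ((k₂.divisors.card : ℝ) * ∑ p ∈ k₂.primeFactors, Real.log p ^ (2 : ℕ)) * (2 * (lam * Real.log M) - 2 * Real.log g - Real.log k₁ - Real.log k₂) ^ (1 : ℕ)) +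
              (3 * E₂₄ / 2 - 4 * E₃₃ + 3 * E₄₂ / 2) * ((k₁.divisors.card : ℝ) * ((k₂.divisors.card : ℝ) * ∑ p ∈ k₂.primeFactors, Real.log p ^ (2 : ℕ)) * (2 * (lam * Real.log M) - 2 * Real.log g - Real.log k₁ - Real.log k₂) ^ (0 : ℕ)) +
              (9 / 640) * ((k₁.divisors.card : ℝ) * (∑ p ∈ k₁.primeFactors, Real.log p ^ (2 : ℕ)) * ((k₂.divisors.card : ℝ) * (∑ p ∈ k₂.primeFactors, Real.log p ^ (2 : ℕ))) * (2 * (lam * Real.log M) - 2 * Real.log g - Real.log k₁ - Real.log k₂) ^ (5 : ℕ)) +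
              (9 * E₀₀ / 64) * ((k₁.divisors.card : ℝ) * (∑ p ∈ k₁.primeFactors, Real.log p ^ (2 : ℕ)) * ((k₂.divisors.card : ℝ) * (∑ p ∈ k₂.primeFactors, Real.log p ^ (2 : ℕ))) * (2 * (lam * Real.log M) - 2 * Real.log g - Real.log k₁ - Real.log k₂) ^ (4 : ℕ)) +
              (9 * E₀₁ / 16 + 9 * E₁₀ / 16 - 15 * μ₂ / 4) * ((k₁.divisors.card : ℝ) * (∑ p ∈ k₁.primeFactors, Real.log p ^ (2 : ℕ)) * ((k₂.divisors.card : ℝ) * (∑ p ∈ k₂.primeFactors, Real.log p ^ (2 : ℕ))) * (2 * (lam * Real.log M) - 2 * Real.log g - Real.log k₁ - Real.log k₂) ^ (3 : ℕ)) +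
              (-9 * E₀₂ / 16 + 9 * E₁₁ / 2 - 9 * E₂₀ / 16) * ((k₁.divisors.card : ℝ) * (∑ p ∈ k₁.primeFactors, Real.log p ^ (2 : ℕ)) * ((k₂.divisors.card : ℝ) * (∑ p ∈ k₂.primeFactors, Real.log p ^ (2 : ℕ))) * (2 * (lam * Real.log M) - 2 * Real.log g - Real.log k₁ - Real.log k₂) ^ (2 : ℕ)) +
              (-9 * E₀₃ / 4 + 9 * E₁₂ / 2 + 9 * E₂₁ / 2 - 9 * E₃₀ / 4 + 105 * μ₄ / 2) * ((k₁.divisors.card : ℝ) * (∑ p ∈ k₁.primeFactors, Real.log p ^ (2 : ℕ)) * ((k₂.divisors.card : ℝ) * (∑ p ∈ k₂.primeFactors, Real.log p ^ (2 : ℕ))) * (2 * (lam * Real.log M) - 2 * Real.log g - Real.log k₁ - Real.log k₂) ^ (1 : ℕ)) +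
              (3 * E₀₄ / 8 - 6 * E₁₃ + 27 * E₂₂ / 2 - 6 * E₃₁ + 3 * E₄₀ / 8) * ((k₁.divisors.card : ℝ) * (∑ p ∈ k₁.primeFactors, Real.log p ^ (2 : ℕ)) * ((k₂.divisors.card : ℝ) * (∑ p ∈ k₂.primeFactors, Real.log p ^ (2 : ℕ))) * (2 * (lam * Real.log M) - 2 * Real.log g - Real.log k₁ - Real.log k₂) ^ (0 : ℕ)) +
              (3 / 1280) * ((k₁.divisors.card : ℝ) * (3 * (∑ p ∈ k₁.primeFactors, Real.log p ^ (2 : ℕ)) ^ (2 : ℕ) - 2 * ∑ p ∈ k₁.primeFactors, Real.log p ^ (4 : ℕ)) * (k₂.divisors.card : ℝ) * (2 * (lam * Real.log M) - 2 * Real.log g - Real.log k₁ - Real.log k₂) ^ (5 : ℕ)) +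
              (3 * E₀₀ / 128) * ((k₁.divisors.card : ℝ) * (3 * (∑ p ∈ k₁.primeFactors, Real.log p ^ (2 : ℕ)) ^ (2 : ℕ) - 2 * ∑ p ∈ k₁.primeFactors, Real.log p ^ (4 : ℕ)) * (k₂.divisors.card : ℝ) * (2 * (lam * Real.log M) - 2 * Real.log g - Real.log k₁ - Real.log k₂) ^ (4 : ℕ)) +
              (3 * E₀₁ / 32 + 3 * E₁₀ / 32 - 5 * μ₂ / 8) * ((k₁.divisors.card : ℝ) * (3 * (∑ p ∈ k₁.primeFactors, Real.log p ^ (2 : ℕ)) ^ (2 : ℕ) - 2 * ∑ p ∈ k₁.primeFactors, Real.log p ^ (4 : ℕ)) * (k₂.divisors.card : ℝ) * (2 * (lam * Real.log M) - 2 * Real.log g - Real.log k₁ - Real.log k₂) ^ (3 : ℕ)) +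
              (-3 * E₀₂ / 32 + 3 * E₁₁ / 4 - 3 * E₂₀ / 32) * ((k₁.divisors.card : ℝ) * (3 * (∑ p ∈ k₁.primeFactors, Real.log p ^ (2 : ℕ)) ^ (2 : ℕ) - 2 * ∑ p ∈ k₁.primeFactors, Real.log p ^ (4 : ℕ)) * (k₂.divisors.card : ℝ) * (2 * (lam * Real.log M) - 2 * Real.log g - Real.log k₁ - Real.log k₂) ^ (2 : ℕ)) +
              (-3 * E₀₃ / 8 + 3 * E₁₂ / 4 + 3 * E₂₁ / 4 - 3 * E₃₀ / 8 + 35 * μ₄ / 4) * ((k₁.divisors.card : ℝ) * (3 * (∑ p ∈ k₁.primeFactors, Real.log p ^ (2 : ℕ)) ^ (2 : ℕ) - 2 * ∑ p ∈ k₁.primeFactors, Real.log p ^ (4 : ℕ)) * (k₂.divisors.card : ℝ) * (2 * (lam * Real.log M) - 2 * Real.log g - Real.log k₁ - Real.log k₂) ^ (1 : ℕ)) +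
              (E₀₄ / 16 - E₁₃ + 9 * E₂₂ / 4 - E₃₁ + E₄₀ / 16) * ((k₁.divisors.card : ℝ) * (3 * (∑ p ∈ k₁.primeFactors, Real.log p ^ (2 : ℕ)) ^ (2 : ℕ) - 2 * ∑ p ∈ k₁.primeFactors, Real.log p ^ (4 : ℕ)) * (k₂.divisors.card : ℝ) * (2 * (lam * Real.log M) - 2 * Real.log g - Real.log k₁ - Real.log k₂) ^ (0 : ℕ)) +
              (3 / 1280) * ((k₁.divisors.card : ℝ) * ((k₂.divisors.card : ℝ) * (3 * (∑ p ∈ k₂.primeFactors, Real.log p ^ (2 : ℕ)) ^ (2 : ℕ) - 2 * ∑ p ∈ k₂.primeFactors, Real.log p ^ (4 : ℕ))) * (2 * (lam * Real.log M) - 2 * Real.log g - Real.log k₁ - Real.log k₂) ^ (5 : ℕ)) +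
              (3 * E₀₀ / 128) * ((k₁.divisors.card : ℝ) * ((k₂.divisors.card : ℝ) * (3 * (∑ p ∈ k₂.primeFactors, Real.log p ^ (2 : ℕ)) ^ (2 : ℕ) - 2 * ∑ p ∈ k₂.primeFactors, Real.log p ^ (4 : ℕ))) * (2 * (lam * Real.log M) - 2 * Real.log g - Real.log k₁ - Real.log k₂) ^ (4 : ℕ)) +
              (3 * E₀₁ / 32 + 3 * E₁₀ / 32 - 5 * μ₂ / 8) * ((k₁.divisors.card : ℝ) * ((k₂.divisors.card : ℝ) * (3 * (∑ p ∈ k₂.primeFactors, Real.log p ^ (2 : ℕ)) ^ (2 : ℕ) - 2 * ∑ p ∈ k₂.primeFactors, Real.log p ^ (4 : ℕ))) * (2 * (lam * Real.log M) - 2 * Real.log g - Real.log k₁ - Real.log k₂) ^ (3 : ℕ)) +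
              (-3 * E₀₂ / 32 + 3 * E₁₁ / 4 - 3 * E₂₀ / 32) * ((k₁.divisors.card : ℝ) * ((k₂.divisors.card : ℝ) * (3 * (∑ p ∈ k₂.primeFactors, Real.log p ^ (2 : ℕ)) ^ (2 : ℕ) - 2 * ∑ p ∈ k₂.primeFactors, Real.log p ^ (4 : ℕ))) * (2 * (lam * Real.log M) - 2 * Real.log g - Real.log k₁ - Real.log k₂) ^ (2 : ℕ)) +
              (-3 * E₀₃ / 8 + 3 * E₁₂ / 4 + 3 * E₂₁ / 4 - 3 * E₃₀ / 8 + 35 * μ₄ / 4) * ((k₁.divisors.card : ℝ) * ((k₂.divisors.card : ℝ) * (3 * (∑ p ∈ k₂.primeFactors, Real.log p ^ (2 : ℕ)) ^ (2 : ℕ) - 2 * ∑ p ∈ k₂.primeFactors, Real.log p ^ (4 : ℕ))) * (2 * (lam * Real.log M) - 2 * Real.log g - Real.log k₁ - Real.log k₂) ^ (1 : ℕ)) +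
              (E₀₄ / 16 - E₁₃ + 9 * E₂₂ / 4 - E₃₁ + E₄₀ / 16) * ((k₁.divisors.card : ℝ) * ((k₂.divisors.card : ℝ) * (3 * (∑ p ∈ k₂.primeFactors, Real.log p ^ (2 : ℕ)) ^ (2 : ℕ) - 2 * ∑ p ∈ k₂.primeFactors, Real.log p ^ (4 : ℕ))) * (2 * (lam * Real.log M) - 2 * Real.log g - Real.log k₁ - Real.log k₂) ^ (0 : ℕ)) +
              (-1 / 384) * ((k₁.divisors.card : ℝ) * (15 * (∑ p ∈ k₁.primeFactors, Real.log p ^ (2 : ℕ)) ^ (3 : ℕ) - 30 * ((∑ p ∈ k₁.primeFactors, Real.log p ^ (2 : ℕ)) * ∑ p ∈ k₁.primeFactors, Real.log p ^ (4 : ℕ)) + 16 * ∑ p ∈ k₁.primeFactors, Real.log p ^ (6 : ℕ)) * (k₂.divisors.card : ℝ) * (2 * (lam * Real.log M) - 2 * Real.log g - Real.log k₁ - Real.log k₂) ^ (3 : ℕ)) +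
              (-E₀₀ / 64) * ((k₁.divisors.card : ℝ) * (15 * (∑ p ∈ k₁.primeFactors, Real.log p ^ (2 : ℕ)) ^ (3 : ℕ) - 30 * ((∑ p ∈ k₁.primeFactors, Real.log p ^ (2 : ℕ)) * ∑ p ∈ k₁.primeFactors, Real.log p ^ (4 : ℕ)) + 16 * ∑ p ∈ k₁.primeFactors, Real.log p ^ (6 : ℕ)) * (k₂.divisors.card : ℝ) * (2 * (lam * Real.log M) - 2 * Real.log g - Real.log k₁ - Real.log k₂) ^ (2 : ℕ)) +
              (-E₀₁ / 32 - E₁₀ / 32 + 7 * μ₂ / 8) * ((k₁.divisors.card : ℝ) * (15 * (∑ p ∈ k₁.primeFactors, Real.log p ^ (2 : ℕ)) ^ (3 : ℕ) - 30 * ((∑ p ∈ k₁.primeFactors, Real.log p ^ (2 : ℕ)) * ∑ p ∈ k₁.primeFactors, Real.log p ^ (4 : ℕ)) + 16 * ∑ p ∈ k₁.primeFactors, Real.log p ^ (6 : ℕ)) * (k₂.divisors.card : ℝ) * (2 * (lam * Real.log M) - 2 * Real.log g - Real.log k₁ - Real.log k₂) ^ (1 : ℕ)) +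
              (3 * E₀₂ / 32 - E₁₁ / 4 + 3 * E₂₀ / 32) * ((k₁.divisors.card : ℝ) * (15 * (∑ p ∈ k₁.primeFactors, Real.log p ^ (2 : ℕ)) ^ (3 : ℕ) - 30 * ((∑ p ∈ k₁.primeFactors, Real.log p ^ (2 : ℕ)) * ∑ p ∈ k₁.primeFactors, Real.log p ^ (4 : ℕ)) + 16 * ∑ p ∈ k₁.primeFactors, Real.log p ^ (6 : ℕ)) * (k₂.divisors.card : ℝ) * (2 * (lam * Real.log M) - 2 * Real.log g - Real.log k₁ - Real.log k₂) ^ (0 : ℕ)) +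
              (-1 / 384) * ((k₁.divisors.card : ℝ) * ((k₂.divisors.card : ℝ) * (15 * (∑ p ∈ k₂.primeFactors, Real.log p ^ (2 : ℕ)) ^ (3 : ℕ) - 30 * ((∑ p ∈ k₂.primeFactors, Real.log p ^ (2 : ℕ)) * ∑ p ∈ k₂.primeFactors, Real.log p ^ (4 : ℕ)) + 16 * ∑ p ∈ k₂.primeFactors, Real.log p ^ (6 : ℕ))) * (2 * (lam * Real.log M) - 2 * Real.log g - Real.log k₁ - Real.log k₂) ^ (3 : ℕ)) +
              (-E₀₀ / 64) * ((k₁.divisors.card : ℝ) * ((k₂.divisors.card : ℝ) * (15 * (∑ p ∈ k₂.primeFactors, Real.log p ^ (2 : ℕ)) ^ (3 : ℕ) - 30 * ((∑ p ∈ k₂.primeFactors, Real.log p ^ (2 : ℕ)) * ∑ p ∈ k₂.primeFactors, Real.log p ^ (4 : ℕ)) + 16 * ∑ p ∈ k₂.primeFactors, Real.log p ^ (6 : ℕ))) * (2 * (lam * Real.log M) - 2 * Real.log g - Real.log k₁ - Real.log k₂) ^ (2 : ℕ)) +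
              (-E₀₁ / 32 - E₁₀ / 32 + 7 * μ₂ / 8) * ((k₁.divisors.card : ℝ) * ((k₂.divisors.card : ℝ) * (15 * (∑ p ∈ k₂.primeFactors, Real.log p ^ (2 : ℕ)) ^ (3 : ℕ) - 30 * ((∑ p ∈ k₂.primeFactors, Real.log p ^ (2 : ℕ)) * ∑ p ∈ k₂.primeFactors, Real.log p ^ (4 : ℕ)) + 16 * ∑ p ∈ k₂.primeFactors, Real.log p ^ (6 : ℕ))) * (2 * (lam * Real.log M) - 2 * Real.log g - Real.log k₁ - Real.log k₂) ^ (1 : ℕ)) +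
              (3 * E₀₂ / 32 - E₁₁ / 4 + 3 * E₂₀ / 32) * ((k₁.divisors.card : ℝ) * ((k₂.divisors.card : ℝ) * (15 * (∑ p ∈ k₂.primeFactors, Real.log p ^ (2 : ℕ)) ^ (3 : ℕ) - 30 * ((∑ p ∈ k₂.primeFactors, Real.log p ^ (2 : ℕ)) * ∑ p ∈ k₂.primeFactors, Real.log p ^ (4 : ℕ)) + 16 * ∑ p ∈ k₂.primeFactors, Real.log p ^ (6 : ℕ))) * (2 * (lam * Real.log M) - 2 * Real.log g - Real.log k₁ - Real.log k₂) ^ (0 : ℕ)) +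
              (-5 / 128) * ((k₁.divisors.card : ℝ) * (3 * (∑ p ∈ k₁.primeFactors, Real.log p ^ (2 : ℕ)) ^ (2 : ℕ) - 2 * ∑ p ∈ k₁.primeFactors, Real.log p ^ (4 : ℕ)) * ((k₂.divisors.card : ℝ) * (∑ p ∈ k₂.primeFactors, Real.log p ^ (2 : ℕ))) * (2 * (lam * Real.log M) - 2 * Real.log g - Real.log k₁ - Real.log k₂) ^ (3 : ℕ)) +
              (-15 * E₀₀ / 64) * ((k₁.divisors.card : ℝ) * (3 * (∑ p ∈ k₁.primeFactors, Real.log p ^ (2 : ℕ)) ^ (2 : ℕ) - 2 * ∑ p ∈ k₁.primeFactors, Real.log p ^ (4 : ℕ)) * ((k₂.divisors.card : ℝ) * (∑ p ∈ k₂.primeFactors, Real.log p ^ (2 : ℕ))) * (2 * (lam * Real.log M) - 2 * Real.log g - Real.log k₁ - Real.log k₂) ^ (2 : ℕ)) +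
              (-15 * E₀₁ / 32 - 15 * E₁₀ / 32 + 105 * μ₂ / 8) * ((k₁.divisors.card : ℝ) * (3 * (∑ p ∈ k₁.primeFactors, Real.log p ^ (2 : ℕ)) ^ (2 : ℕ) - 2 * ∑ p ∈ k₁.primeFactors, Real.log p ^ (4 : ℕ)) * ((k₂.divisors.card : ℝ) * (∑ p ∈ k₂.primeFactors, Real.log p ^ (2 : ℕ))) * (2 * (lam * Real.log M) - 2 * Real.log g - Real.log k₁ - Real.log k₂) ^ (1 : ℕ)) +
              (45 * E₀₂ / 32 - 15 * E₁₁ / 4 + 45 * E₂₀ / 32) * ((k₁.divisors.card : ℝ) * (3 * (∑ p ∈ k₁.primeFactors, Real.log p ^ (2 : ℕ)) ^ (2 : ℕ) - 2 * ∑ p ∈ k₁.primeFactors, Real.log p ^ (4 : ℕ)) * ((k₂.divisors.card : ℝ) * (∑ p ∈ k₂.primeFactors, Real.log p ^ (2 : ℕ))) * (2 * (lam * Real.log M) - 2 * Real.log g - Real.log k₁ - Real.log k₂) ^ (0 : ℕ)) +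
              (-5 / 128) * ((k₁.divisors.card : ℝ) * (∑ p ∈ k₁.primeFactors, Real.log p ^ (2 : ℕ)) * ((k₂.divisors.card : ℝ) * (3 * (∑ p ∈ k₂.primeFactors, Real.log p ^ (2 : ℕ)) ^ (2 : ℕ) - 2 * ∑ p ∈ k₂.primeFactors, Real.log p ^ (4 : ℕ))) * (2 * (lam * Real.log M) - 2 * Real.log g - Real.log k₁ - Real.log k₂) ^ (3 : ℕ)) +
              (-15 * E₀₀ / 64) * ((k₁.divisors.card : ℝ) * (∑ p ∈ k₁.primeFactors, Real.log p ^ (2 : ℕ)) * ((k₂.divisors.card : ℝ) * (3 * (∑ p ∈ k₂.primeFactors, Real.log p ^ (2 : ℕ)) ^ (2 : ℕ) - 2 * ∑ p ∈ k₂.primeFactors, Real.log p ^ (4 : ℕ))) * (2 * (lam * Real.log M) - 2 * Real.log g - Real.log k₁ - Real.log k₂) ^ (2 : ℕ)) +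
              (-15 * E₀₁ / 32 - 15 * E₁₀ / 32 + 105 * μ₂ / 8) * ((k₁.divisors.card : ℝ) * (∑ p ∈ k₁.primeFactors, Real.log p ^ (2 : ℕ)) * ((k₂.divisors.card : ℝ) * (3 * (∑ p ∈ k₂.primeFactors, Real.log p ^ (2 : ℕ)) ^ (2 : ℕ) - 2 * ∑ p ∈ k₂.primeFactors, Real.log p ^ (4 : ℕ))) * (2 * (lam * Real.log M) - 2 * Real.log g - Real.log k₁ - Real.log k₂) ^ (1 : ℕ)) +
              (45 * E₀₂ / 32 - 15 * E₁₁ / 4 + 45 * E₂₀ / 32) * ((k₁.divisors.card : ℝ) * (∑ p ∈ k₁.primeFactors, Real.log p ^ (2 : ℕ)) * ((k₂.divisors.card : ℝ) * (3 * (∑ p ∈ k₂.primeFactors, Real.log p ^ (2 : ℕ)) ^ (2 : ℕ) - 2 * ∑ p ∈ k₂.primeFactors, Real.log p ^ (4 : ℕ))) * (2 * (lam * Real.log M) - 2 * Real.log g - Real.log k₁ - Real.log k₂) ^ (0 : ℕ)) +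
              (1 / 512) * ((k₁.divisors.card : ℝ) * (105 * (∑ p ∈ k₁.primeFactors, Real.log p ^ (2 : ℕ)) ^ (4 : ℕ) - 420 * (∑ p ∈ k₁.primeFactors, Real.log p ^ (2 : ℕ)) ^ (2 : ℕ) * (∑ p ∈ k₁.primeFactors, Real.log p ^ (4 : ℕ)) + 448 * (∑ p ∈ k₁.primeFactors, Real.log p ^ (2 : ℕ)) * (∑ p ∈ k₁.primeFactors, Real.log p ^ (6 : ℕ)) + 140 * (∑ p ∈ k₁.primeFactors, Real.log p ^ (4 : ℕ)) ^ (2 : ℕ) - 272 * ∑ p ∈ k₁.primeFactors, Real.log p ^ (8 : ℕ)) * (k₂.divisors.card : ℝ) * (2 * (lam * Real.log M) - 2 * Real.log g - Real.log k₁ - Real.log k₂) ^ (1 : ℕ)) +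
              (E₀₀ / 256) * ((k₁.divisors.card : ℝ) * (105 * (∑ p ∈ k₁.primeFactors, Real.log p ^ (2 : ℕ)) ^ (4 : ℕ) - 420 * (∑ p ∈ k₁.primeFactors, Real.log p ^ (2 : ℕ)) ^ (2 : ℕ) * (∑ p ∈ k₁.primeFactors, Real.log p ^ (4 : ℕ)) + 448 * (∑ p ∈ k₁.primeFactors, Real.log p ^ (2 : ℕ)) * (∑ p ∈ k₁.primeFactors, Real.log p ^ (6 : ℕ)) + 140 * (∑ p ∈ k₁.primeFactors, Real.log p ^ (4 : ℕ)) ^ (2 : ℕ) - 272 * ∑ p ∈ k₁.primeFactors, Real.log p ^ (8 : ℕ)) * (k₂.divisors.card : ℝ) * (2 * (lam * Real.log M) - 2 * Real.log g - Real.log k₁ - Real.log k₂) ^ (0 : ℕ)) +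
              (1 / 512) * ((k₁.divisors.card : ℝ) * ((k₂.divisors.card : ℝ) * (105 * (∑ p ∈ k₂.primeFactors, Real.log p ^ (2 : ℕ)) ^ (4 : ℕ) - 420 * (∑ p ∈ k₂.primeFactors, Real.log p ^ (2 : ℕ)) ^ (2 : ℕ) * (∑ p ∈ k₂.primeFactors, Real.log p ^ (4 : ℕ)) + 448 * (∑ p ∈ k₂.primeFactors, Real.log p ^ (2 : ℕ)) * (∑ p ∈ k₂.primeFactors, Real.log p ^ (6 : ℕ)) + 140 * (∑ p ∈ k₂.primeFactors, Real.log p ^ (4 : ℕ)) ^ (2 : ℕ) - 272 * ∑ p ∈ k₂.primeFactors, Real.log p ^ (8 : ℕ))) * (2 * (lam * Real.log M) - 2 * Real.log g - Real.log k₁ - Real.log k₂) ^ (1 : ℕ)) +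
              (E₀₀ / 256) * ((k₁.divisors.card : ℝ) * ((k₂.divisors.card : ℝ) * (105 * (∑ p ∈ k₂.primeFactors, Real.log p ^ (2 : ℕ)) ^ (4 : ℕ) - 420 * (∑ p ∈ k₂.primeFactors, Real.log p ^ (2 : ℕ)) ^ (2 : ℕ) * (∑ p ∈ k₂.primeFactors, Real.log p ^ (4 : ℕ)) + 448 * (∑ p ∈ k₂.primeFactors, Real.log p ^ (2 : ℕ)) * (∑ p ∈ k₂.primeFactors, Real.log p ^ (6 : ℕ)) + 140 * (∑ p ∈ k₂.primeFactors, Real.log p ^ (4 : ℕ)) ^ (2 : ℕ) - 272 * ∑ p ∈ k₂.primeFactors, Real.log p ^ (8 : ℕ))) * (2 * (lam * Real.log M) - 2 * Real.log g - Real.log k₁ - Real.log k₂) ^ (0 : ℕ)) +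
              (7 / 128) * ((k₁.divisors.card : ℝ) * (15 * (∑ p ∈ k₁.primeFactors, Real.log p ^ (2 : ℕ)) ^ (3 : ℕ) - 30 * ((∑ p ∈ k₁.primeFactors, Real.log p ^ (2 : ℕ)) * ∑ p ∈ k₁.primeFactors, Real.log p ^ (4 : ℕ)) + 16 * ∑ p ∈ k₁.primeFactors, Real.log p ^ (6 : ℕ)) * ((k₂.divisors.card : ℝ) * (∑ p ∈ k₂.primeFactors, Real.log p ^ (2 : ℕ))) * (2 * (lam * Real.log M) - 2 * Real.log g - Real.log k₁ - Real.log k₂) ^ (1 : ℕ)) +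
              (7 * E₀₀ / 64) * ((k₁.divisors.card : ℝ) * (15 * (∑ p ∈ k₁.primeFactors, Real.log p ^ (2 : ℕ)) ^ (3 : ℕ) - 30 * ((∑ p ∈ k₁.primeFactors, Real.log p ^ (2 : ℕ)) * ∑ p ∈ k₁.primeFactors, Real.log p ^ (4 : ℕ)) + 16 * ∑ p ∈ k₁.primeFactors, Real.log p ^ (6 : ℕ)) * ((k₂.divisors.card : ℝ) * (∑ p ∈ k₂.primeFactors, Real.log p ^ (2 : ℕ))) * (2 * (lam * Real.log M) - 2 * Real.log g - Real.log k₁ - Real.log k₂) ^ (0 : ℕ)) +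
              (7 / 128) * ((k₁.divisors.card : ℝ) * (∑ p ∈ k₁.primeFactors, Real.log p ^ (2 : ℕ)) * ((k₂.divisors.card : ℝ) * (15 * (∑ p ∈ k₂.primeFactors, Real.log p ^ (2 : ℕ)) ^ (3 : ℕ) - 30 * ((∑ p ∈ k₂.primeFactors, Real.log p ^ (2 : ℕ)) * ∑ p ∈ k₂.primeFactors, Real.log p ^ (4 : ℕ)) + 16 * ∑ p ∈ k₂.primeFactors, Real.log p ^ (6 : ℕ))) * (2 * (lam * Real.log M) - 2 * Real.log g - Real.log k₁ - Real.log k₂) ^ (1 : ℕ)) +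
              (7 * E₀₀ / 64) * ((k₁.divisors.card : ℝ) * (∑ p ∈ k₁.primeFactors, Real.log p ^ (2 : ℕ)) * ((k₂.divisors.card : ℝ) * (15 * (∑ p ∈ k₂.primeFactors, Real.log p ^ (2 : ℕ)) ^ (3 : ℕ) - 30 * ((∑ p ∈ k₂.primeFactors, Real.log p ^ (2 : ℕ)) * ∑ p ∈ k₂.primeFactors, Real.log p ^ (4 : ℕ)) + 16 * ∑ p ∈ k₂.primeFactors, Real.log p ^ (6 : ℕ))) * (2 * (lam * Real.log M) - 2 * Real.log g - Real.log k₁ - Real.log k₂) ^ (0 : ℕ)) +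
              (35 / 256) * ((k₁.divisors.card : ℝ) * (3 * (∑ p ∈ k₁.primeFactors, Real.log p ^ (2 : ℕ)) ^ (2 : ℕ) - 2 * ∑ p ∈ k₁.primeFactors, Real.log p ^ (4 : ℕ)) * ((k₂.divisors.card : ℝ) * (3 * (∑ p ∈ k₂.primeFactors, Real.log p ^ (2 : ℕ)) ^ (2 : ℕ) - 2 * ∑ p ∈ k₂.primeFactors, Real.log p ^ (4 : ℕ))) * (2 * (lam * Real.log M) - 2 * Real.log g - Real.log k₁ - Real.log k₂) ^ (1 : ℕ)) +
              (35 * E₀₀ / 128) * ((k₁.divisors.card : ℝ) * (3 * (∑ p ∈ k₁.primeFactors, Real.log p ^ (2 : ℕ)) ^ (2 : ℕ) - 2 * ∑ p ∈ k₁.primeFactors, Real.log p ^ (4 : ℕ)) * ((k₂.divisors.card : ℝ) * (3 * (∑ p ∈ k₂.primeFactors, Real.log p ^ (2 : ℕ)) ^ (2 : ℕ) - 2 * ∑ p ∈ k₂.primeFactors, Real.log p ^ (4 : ℕ))) * (2 * (lam * Real.log M) - 2 * Real.log g - Real.log k₁ - Real.log k₂) ^ (0 : ℕ))) -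
        (fun lam P ↦ (π ^ (2 : ℕ) / 6) ^ (2 : ℕ) * ((1 / 4608) * (∑ j ∈ Finset.range (9 + 1), ∑ i ∈ Finset.range (j + 1),
            ((9 : ℕ).choose j : ℝ) * (j.choose i : ℝ) * 2 ^ (9 - j) *
              ∫ u in (0 : ℝ)..1, (((Polynomial.C lam - X) ^ (9 - j) * derivative (derivative (X ^ i * P))) *
                derivative (derivative (X ^ (j - i) * P))).eval u) +
          (-1 / 448) * (∑ j ∈ Finset.range (7 + 1), ∑ i ∈ Finset.range (j + 1),
            ((7 : ℕ).choose j : ℝ) * (j.choose i : ℝ) * 2 ^ (7 - j) *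
              ∫ u in (0 : ℝ)..1, (((Polynomial.C lam - X) ^ (7 - j) * (-(2 : ℝ) • (X ^ i * P))) *
                derivative (derivative (X ^ (j - i) * P))).eval u) +
          (9 / 640) * (∑ j ∈ Finset.range (5 + 1), ∑ i ∈ Finset.range (j + 1),
            ((5 : ℕ).choose j : ℝ) * (j.choose i : ℝ) * 2 ^ (5 - j) *
              ∫ u in (0 : ℝ)..1, (((Polynomial.C lam - X) ^ (5 - j) * (-(2 : ℝ) • (X ^ i * P))) *
                (-(2 : ℝ) • (X ^ (j - i) * P))).eval u))) lam P * Real.log M ^ (6 : ℕ)| ≤ C * Real.log M ^ (5 : ℕ) := by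
  intro P hP0 hP1 lam hlam0 hlam1 E₀₀ E₀₁ E₀₂ E₀₃ E₀₄ E₁₀ E₁₁ E₁₂ E₁₃ E₁₄ E₂₀ E₂₁ E₂₂ E₂₃ E₂₄ E₃₀ E₃₁ E₃₂ E₃₃ E₃₄ E₄₀ E₄₁ E₄₂ E₄₃ E₄₄ μ₂ μ₄ μ₆ μ₈
  exact abs_selbergOrderFourFourPoly_sub_le P hP0 hP1 hlam0 hlam1 E₀₀ E₀₁ E₀₂ E₀₃ E₀₄ E₁₀ E₁₁ E₁₂ E₁₃ E₁₄ E₂₀ E₂₁ E₂₂ E₂₃ E₂₄ E₃₀ E₃₁ E₃₂ E₃₃ E₃₄ E₄₀ E₄₁ E₄₂ E₄₃ E₄₄ μ₂ μ₄ μ₆ μ₈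

end Summit.Parity.GeneralizedHardyLittlewood.Theorems.MomentsBeyondDiagonal.DiagKernel

end
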